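import Summits.BirchSwinnertonDyer.BirchSwinnertonDyer.Theses.ErratumRoadFive
import Literature.NumberTheory.EllipticCurves.Kato2004.AdmissibleZetaClassRealisability
import Literature.NumberTheory.EllipticCurves.Kato2004.AdmissibleZetaClassLengthInequality
import Literature.NumberTheory.EllipticCurves.Kato2004.IwasawaH2FineSelmerDualCountRankFree
import Literature.NumberTheory.EllipticCurves.MordellWeilTheoremProofs
import Literature.NumberTheory.EllipticCurves.TateModuleContinuityProofs
import Literature.NumberTheory.EllipticCurves.LeadingTerm
import Literature.NumberTheory.EllipticCurves.Rank1Residual.Typed.Basic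
import Summits.BirchSwinnertonDyer.BirchSwinnertonDyer.Theorems.ErratumRoadFiveRamFreeTamagawaDescent
import Summits.BirchSwinnertonDyer.BirchSwinnertonDyer.Theorems.CongruentShaFreeCutKatoKummerLogTorsion
import Summits.BirchSwinnertonDyer.Rank1Residual.Additive.LocalLogImageRat
import Summits.BirchSwinnertonDyer.Rank1Residual.Additive.LocalTorsionExponent
import Literature.NumberTheory.EllipticCurves.TamagawaRingEquivProofs
import Literature.NumberTheory.EllipticCurves.TamagawaPrimesEquivProofs
import Literature.NumberTheory.EllipticCurves.PastenValuationProductThm115Proofs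
import Literature.NumberTheory.EllipticCurves.MatsunoCurvesRankProofs
import Literature.NumberTheory.EllipticCurves.PadicFiltrationIndexProofs
import Literature.NumberTheory.EllipticCurves.TamagawaSubgroupProofs
import Literature.NumberTheory.DiophantineGeometry.TameAdditiveTypesAtTwoProofs
import Summits.BirchSwinnertonDyer.BirchSwinnertonDyer.Theorems.ErratumRoadFiveKatoFframeS1Lambda
import Summits.BirchSwinnertonDyer.BirchSwinnertonDyer.Theorems.ErratumRoadFiveKatoFframeValueAtoms
import Literature.NumberTheory.EllipticCurves.BeilinsonKatoRankOneNonvanishing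
import Literature.NumberTheory.EllipticCurves.NonEisensteinPrimeOfSurjective
import Literature.NumberTheory.EllipticCurves.CaiShuTian2014.HeegnerConditionProofs
import HarnessLib

/-!

**rev 5.7 (cell pen bsd-stepL-plan g50, 2026-08-30, PEN-MECHANICAL per director-bsd (560)(1): the two research ATOMS are now ROUTE
ITEMS of `Theses/ErratumRoadFive.lean`, read here BY NAME).** rev 5.6 (bd976d191c265a9a) with exactly TWO statement-level hunks and NO
import change: the registered stubs `stub_valuationIneqSplit` / `stub_valuationIneqNonsplit` now have as their statements the route decls
`Summit.BirchSwinnertonDyer.BirchSwinnertonDyer.Theses.ErratumRoadFive.KatoValuationIneqSplitAtFive` (item stmt-BirchSwinnertonDyer-33168, aside r401)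
/ `….KatoValuationIneqNonsplitAtFive` (item stmt-BirchSwinnertonDyer-33169, aside r402) — «declared LINE-RESIDUAL research atoms of crux 19715»,
filed by the pen (edit e27bd3e9a92d0db3, referee g86 PRE-VERIFIED 12:25:02Z) with texts = the rev 5.6 stub texts VERBATIM, names fully
qualified (kernel: `example : KatoValuationIneqSplitAtFive ↔ (<rev 5.6 text>) := Iff.rfl` ×2, pen sketch 702e85b98cbb3e5c, farm rc 0 —
so the rebind is DEFINITIONAL and every consumer (`stub_integralExcZeroValue`, `stub_integralNonsplitValue`, hence `_of_stubs`)
elaborates unchanged by delta-unfolding). Effect: a prover who lands `theorem … : Theses.ErratumRoadFive.KatoValuationIneqSplitAtFive`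
in `Theorems/` closes the route item AND discharges this stub by name; sorries 3 → 3 ({S0′ CITE ×7, the two atoms}); `_of` ∕ `_of4` ∕
`_of_stubs` ∕ S1Λ ∕ S2″ ∕ S2ns ∕ S3 ∕ S3ns byte-identical to rev 5.6.
**rev 5.6 CANDIDATE (LEAD er5-p1 g11, 2026-08-30; for the pen to key per W-79 — or not: the (α) item filing is an equivalent
bookkeeping; this candidate makes the REGISTERED stubs coincide with the research ATOMS).** rev 5.5 + FOUR imports
(`Theorems.ErratumRoadFiveKatoFframeValueAtoms` p766845 — S3/S3ns from atoms; `Literature.…BeilinsonKatoRankOneNonvanishing` p768048 —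
the two PRINTED rank-one non-vanishings of Kato's class as named facts (Venerucci 2016 Thm. A/B split; BDV 2022 Thm. A via Kim 2022,
`p` odd, `p² ∤ N`); `NonEisensteinPrimeOfSurjective` — `ρ̄` onto ⇒ irreducible; `CaiShuTian2014.HeegnerConditionProofs` — `f_p = 1` at a
multiplicative prime) and THREE statement-level changes: (i) S0 `stub_printedFactsHeld` WIDENED from 4 to 7 named facts (+ GZ86 I.(7.3)
`GrossZagier1986_thm_I_7_3`, + `Venerucci2016_kummerLog_bottomLayer_ne_zero_split`, + `BertoliniDarmonVenerucci2022_kummerLog_bottomLayer_ne_zero`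
— CITE ×7, closed at route level by `(h : Fact)` binders as before); (ii) TWO NEW STUBS `stub_valuationIneqSplit` /
`stub_valuationIneqNonsplit` = the pure valuation inequalities (the binders `hVsplit` / `hVnonsplit` of
`ErratumRoadFiveKatoFframeValueAtoms.integral{ExcZero,Nonsplit}Value_of_atoms` VERBATIM; referee g86 token records 819/821) — the
ONLY research content of the line; (iii) S3 `stub_integralExcZeroValue` and S3ns `stub_integralNonsplitValue` are now THEOREMS
(statements byte-identical to rev 5.5): `:= integral{ExcZero,Nonsplit}Value_of_atoms` fed by S0's facts (GZK, GZ86, Venerucci∕BDV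
through the two in-file reshaping lemmas of §1b) and the new stubs, `bottomClass`∕`logOmega` unfolding definitionally. `_of` ∕ `_of4`
∕ S1Λ ∕ S2″ ∕ S2ns byte-identical; `_of_stubs` reads S0's seven conjuncts. Sorries 3 → 3, but now {S0 (CITE ×7), stub_valuationIneqSplit,
stub_valuationIneqNonsplit}: every registered stub is either a bundle of Literature named facts or ONE pure research inequality.
**rev 5.5 (LEAD er5-p1 g9, 2026-08-30; for the pen to key per W-79):** rev 5.4 + ONE import (`Theorems.ErratumRoadFiveKatoFframeS1Lambda`, the LEAD's S1Λ closer) + the `sorry` of S1Λ `stub_katoLambdaLogBoundTamagawa` REPLACED by `ErratumRoadFiveKatoFframeS1Lambda.katoLambdaLogBoundTamagawa` (its r5.4 signature, GZK → F1′ → H2Xʳ → body, is now a THEOREM of the tree: R-C = (R1-d) at the bad `ℓ ≠ p` of ANY reduction type, `Theorems/ErratumRoadFiveKatoFframe{LocalLiftFixedPoints,LocalLift,LocalIndexCount,LocalIndex,KummerUnramifiedBadA–D}` + the sub-class chain of p764175). NO statement changed: every stub signature, `_of` / `_of4` / `_of_stubs`, S0 / S2″ / S2ns / S3 / S3ns byte-identical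 to rev 5.4. Sorries 4 → 3: S0 `stub_printedFactsHeld` (CITE ×4 by design), S3 `stub_integralExcZeroValue`, S3ns `stub_integralNonsplitValue` (research doors).
**rev 5.4 (cell pen bsd-stepL-plan g48 for LEAD er5-p1 g8, ruling 06:12:43Z 2026-08-30 «no r5.3; key r5.4 instead — ONE re-key»):** rev 5.2 + TWO imports (`Kato2004.AdmissibleZetaClassLengthInequality` p763175, `Kato2004.IwasawaH2FineSelmerDualCountRankFree` (guarded variant 1dc7aff35d6b5e7f)) + S0 `stub_printedFactsHeld` WIDENED to «GZK ∧ realisability ∧ F1′ ∧ H2Xʳ» (named facts = hypotheses, not theorems) + S1Λ `stub_katoLambdaLogBoundTamagawa` takes «GZK → F1′ → H2Xʳ →» as LEADING HYPOTHESES (body after them byte-identical to rev 5.2; its kernel proof consumes exactly these three by name: GZK for `Finite Ш`, F1′ for the length bound, H2Xʳ for the same-`J` count) + `_of_stubs := _of4 ⟨S0.1, S0.2.1⟩ (S1Λ S0.1 S0.2.2.1 S0.2.2.2) S3 S3ns`. `_of` / `_of4` / S2″ / S2ns / S3 / S3ns byte-identical. Stub NAMES and COUNT unchanged (4); registered signatures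 of S0 and S1Λ change. r5.3 (F1′ alone, 374571e9f0fc823a) is WITHDRAWN unkeyed.
(rev 5.2 — PEN-MECHANICAL, cell pen bsd-stepL-plan g48 as lead-of-record on 19715 (RULING 114), 2026-08-30 ≈05:30Z, on top of
rev 5.1 dbb1e369a3bd40ab by bsd-idea-9 g39: NO statement, stub, hypothesis list or proof step changed. The gate `skeleton check`
(`HarnessLib.Audit.Check.checkSkeletonCore`) takes an ARBITRARY one of the theorems whose conclusion head is the crux decl and
bounced rev 5.1 with `skeleton.extra-hypothesis` ×4 because it picked the CONDITIONAL composition `_of4` (4 Prop binders) instead of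
`_of_stubs`. Fix, three hunks: (i) the two conditional compositions `EulerHalfNotRamNoInertSetAtFive_of` (6 binders) and `_of4`
(4 binders) now state their result as `id EulerHalfNotRamNoInertSetAtFive` (definitionally the crux; the wrapper only hides the
head constant from the candidate scan); (ii) `_of_stubs : EulerHalfNotRamNoInertSetAtFive` — the ONLY theorem of this file
concluding the crux BY NAME — is moved after `_of4` and proved as `_of4 <the four stubs by name>` (so `_of4` and `_of` sit in its
cone: no orphan); (iii) this paragraph and two docstring sentences. Farm + gate outputs are quoted on HOME/STATUS.md at registration.)
(rev 5.1 CANDIDATE `Lines/kato_Fframe_r5.lean` — g39 04:50Z, written at the pen's request (GATE B PEN INTENT rev 3, 04:32:56Z):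
rev 5 (84411ffe10ff927c) with rev 4.1's comment-only hunks applied (the S3ns print-status correction and its echoes; header text
below = rev 4.1 1e3ca759eb3226d8); CODE-ONLY ≡ rev 5 — every declaration, binder and proof byte is rev 5's. rev 5 = identical to
rev 4 `Lines/kato_Fframe_r4.lean` f94d5116aef1b815
(the tree of record for GATE B, untouched) except that the two WIDTH stubs S2″/S2ns are now THEOREMS proved inline from tree
theorems (bodies of the workfiles `Lines/kato_Fframe_r4_S2split_proof.lean` rev 2 7e5305b10ca8, `Lines/kato_Fframe_r4_S2ns_proof.lean`
7ba4e1ebe3e9); FOUR stubs remain: S0 `stub_printedFactsHeld`, S1Λ `stub_katoLambdaLogBoundTamagawa`, S3 `stub_integralExcZeroValue`,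
S3ns `stub_integralNonsplitValue`; compositions `EulerHalfNotRamNoInertSetAtFive_of` (6 binders, as rev 4), `_of4` (4 binders), `_of_stubs`.
Not a registration (W-79); offered to the pen / LEAD for AFTER GATE B; nothing here asks to re-key before 09Z.)

# Line `kato_Fframe` — STAGE 1 skeleton of the door «kato-bottom-layer-exczero» on
# `ErratumRoadFive.EulerHalfNotRamNoInertSetAtFive` (stmt-BirchSwinnertonDyer-19715) — rev 5.1 CANDIDATE (Λ-TAM; header = rev 4.1, S2″/S2ns proved)

DRAFT TURNKEY (planner-bsd-idea-9 g39, lens = complete). rev 2 (c6ad67b45cb26edf) stands at `Lines/kato_Fframe.lean`,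
rev 3.1 (a2d17d87f6602fc8, critic V265/V269 PASS, GATE B option (a″)) at `Lines/kato_Fframe_r3.lean`; THIS file is the
rev-4 CANDIDATE at a THIRD path (`Lines/kato_Fframe_r4.lean`) so that the objects priced for GATE B are untouched — a
drop-in replacement (same namespace, same composition name `EulerHalfNotRamNoInertSetAtFive_of`) that the route pen /
LEAD may key INSTEAD of rev 3.1, at GATE B or later. Published by `ledger crux write` ONLY; NOT registered (W-79: the
line of record on 19715 stays `Lines/birth.lean` v17 until the pen decides otherwise). Nothing here is a route item;
no summit statement, crux or stub is proved by this file; BSD is proved for no curve. Crux idea card of the lever: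
`Ideas/lambda-tamagawa-recovery.md`; line card `Lines/kato_Fframe_r4.md`.
rev 4.1 (same path, 2026-08-30 g39): DOCSTRING-ONLY correction of S3ns's print-status paragraph (the rational form of
Perrin-Riou's conjecture at `p ∥ N`, either sign, is attributed to BDV 2022 by Kim 2021/2025 — rev 4 said «not even up
to ℚˣ»; the INTEGRAL form S3ns needs stays open in print, as S3's); in rev 4.1 every declaration, binder and proof is rev 4's
(f94d5116aef1b815) byte for byte, and in THIS rev 5.1 every declaration, binder and proof is rev 5's (84411ffe10ff927c)
byte for byte. Memo of the lever's proof: `Lines/kato_Fframe_r4_LambdaTAM.md`.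

## What rev 4 changes (one lever, two consequences)

rev 3.1 left TWO things outside the door: (J2) the print-open stub S1♯′ — the Kolyvagin-system defect as a SUM over
the places carrying `p` in `∏_{ℓ≠p} c_ℓ · #E(ℚ_p)[p^∞]` (Büyükboduk's Question 2; catalogued barrier
`StringentKolyvaginCapsAtMax` bites head-on: local-condition refinements of `KS(T_pE, F_can)` over `ℚ` give the MAXIMUM
over places, never the sum) — and (J1) the honest residual S4′ = the crux at a NON-SPLIT multiplicative `p` (34 of the
404 census pairs). rev 4's lever removes the first and reduces the second to a Perrin-Riou VALUE statement:

LEMMA Λ-TAM («Tamagawa recovery by Λ-adic divisibility descended through the FINE Selmer group at `T = 0`»; ours,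
print-assembled — the three inputs are printed theorems, the assembled statement is not in print; nearest print =
Wuthrich's leading-term formula for the fine Selmer group, J. Algebraic Geom. 16 (2007), at POTENTIALLY GOOD `p`).
Setting: `p ≥ 5`, `ρ̄_{E,p}` onto (so `ρ_{E,p}` onto, Serre), `r_an = 1` (so rank 1, `Ш[p^∞]` finite, GZK), `p`
multiplicative (split OR non-split), `Σ = {p, ∞} ∪ {ℓ ∣ N}`, `T = T_pE`, `A = E[p^∞]`, `Λ = ℤ_p[[Γ]]`, `Γ = Gal(ℚ_∞/ℚ)`.
(A) `H := H¹(G_Σ,T) = H¹_f(ℚ,T) = ℤ_p·x̂` (`x̂` a Mordell–Weil generator: `H_tors = E(ℚ)[p^∞] = 0`; `H²(G_Σ,V) ≅ Ш¹(G_Σ,V)^*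
= 0` because `Ш¹(V) ⊂ ℚ_p x̂` and `loc_p x̂ ≠ 0`; `H/H¹_f ↪ H¹(ℚ_p,T)/H¹_f` torsion-free and `H¹(ℚ_ℓ,V) = 0` at `ℓ ∥ N`).
`M := H¹_Iw(G_Σ,T)` (`=` Kato's `𝐇¹` in the Γ-direction: the punctual terms `⊕_{w∣ℓ} H¹(I_ℓ,T)^{Frob_w} ≅ ℤ/c_ℓ^{(p)}`
die in `lim←` under `cores = ×p`) is Λ-FREE OF RANK ONE (Kato Thm. 12.4 (3): `p ≠ 2`, `E[p]` irreducible); the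
descent sequence `0 → M/TM → H → H²_Iw(G_Σ,T)[T] → 0` (cohomology of `0 → T⊗Λ →(γ−1) T⊗Λ → T → 0`, `cd_p G_Σ = 2`) makes
`N := im(M → H) = p^a ℤ_p x̂` (the global universal norms; `a < ∞` for free). Write the admissible class as
`z^Λ = g̃·w̄` (`w̄` a Λ-basis of `M`, `g̃ ∈ Λ`); its bottom layer is `z₁ = g̃(0)·p^a·u·x̂`, so
`ind_H(z₁) = ord_p g̃(0) + a = ord_p t − ord_p log_ω(x̂)` (`t = log_ω loc_p z₁`; `loc_p ∘ log_ω` is injective on `H`).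
(B) DIVISIBILITY. `Y := Sel₀(E/ℚ_∞)[p^∞]^∨ = ker(H²_Iw(G_Σ,T) → ⊕_{v∈Σ_f} H²_Iw(ℚ_v,T))` (Poitou–Tate) embeds in Kato's
`𝐇²_Γ` with cokernel inside `(E(ℚ_{p,∞})[p^∞])^∨` (tree `Kato2004/IwasawaH2FineSelmerDualComparison.lean`; Kurihara
2002 / Kobayashi 2003 `0 → X₀ → 𝐇² → 𝐇²_loc`); Kato Thm. 12.5 (4) [Astérisque 295 p. 222] under (12.5.2) (⇐ `ρ̄` onto,
`p ≥ 5`): `length_𝔭 𝐇²_𝔭 ≤ length_𝔭 (𝐇¹/Z(f,T))_𝔭 ≤ length_𝔭 (M/Λz^Λ)_𝔭` at every height-one `𝔭` of `ℤ_p[[Γ]]` «unless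
(12.5.1)» — and the (12.5.1) exception cannot occur in the Γ-component: there `𝐇²_loc = (E(ℚ_{p,∞})[p^∞])^∨` is
FINITE (`μ_p ⊄ ℚ_{p,∞}`; split `p`: `E(ℚ_{p,∞})[p^∞] = E(ℚ_p)[p^∞]`, r3.1 header; non-split `p ≥ 5`: `= 0`), i.e.
pseudo-null, while (12.5.1) requires `length_𝔭 𝐇²_loc,𝔭 = 1` (the Tate-period prime `𝔭` lives in a `Δ`-component
with `χ∣_Δ = ω⁻¹ ≠ 1`). Hence `char_Λ Y ∣ (g̃)` and, `Y_Γ` being finite ((C) below), `f_Y(0) ≠ 0` and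
`ord_p f_Y(0) = len Y_Γ − len Y^Γ ≤ ord_p g̃(0) = ind_H(z₁) − a`. No main conjecture, no `p`-adic `L`-function, no
`μ = 0` is used — one divisibility, at the bottom prime `(T)` only.
(C) CONTROL for the FINE Selmer group in rank one (Greenberg's diagram with the strict condition at every `v ∈ Σ_f`;
`E(ℚ_∞)[p^∞] = 0`, `cd Γ = 1`): `Sel₀(ℚ,A) ↪ Sel₀(ℚ_∞,A)^Γ` with cokernel `im(loc) ∩ ⊕_v K_v`, `K_v := ker(H¹(ℚ_v,A) →
H¹(ℚ_{∞,w},A)) = H¹(Γ_v, E(ℚ_{v,∞})[p^∞])`; `im(loc) = loc(H)^⊥` (Poitou–Tate, `H¹(ℝ,A) = 0`) and `K_v^⊥ = N_v :=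
im(H¹_Iw(ℚ_v,T) → H¹(ℚ_v,T))` (res/cor adjoint under Tate local duality), so with `H = ℤ_p x̂` CYCLIC:
`#coker = ∏_v #K_v / p^{max_v e_v}`, `e_v :=` exponent of `loc_v x̂` in `H¹(ℚ_v,T)/N_v`. Orders: `#K_ℓ = c_ℓ^{(p)}` for
`ℓ ≠ p` (Greenberg, LNM 1716, Lemma 3.3 and p. 88: «`= c_v^{(p)}` for all `n`» at split multiplicative `ℓ`, `1` at
non-split `ℓ` (`p` odd) and at additive `ℓ` (`p ≥ 5`) — `= c_ℓ^{(p)}` in every case; the fine local condition at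
`ℓ ≠ p` IS Greenberg's `ℋ_E(ℚ_ℓ) = H¹(ℚ_ℓ,A)`); `#K_p = #H¹(Γ_p, E(ℚ_{p,∞})[p^∞]) = #E(ℚ_p)[p^∞] =: p^m` at split `p`
(finite module with trivial `Γ_p`-action) and `= 1` at non-split `p ≥ 5` — Wuthrich's `Tors_{ℤ_p} D_{E,p}`, Ray–Sujatha's
«local torsion» (NOT Greenberg's Selmer kernel `∼ log_p(q_E)/2p` at split `p`, which belongs to the `im κ` condition
and does not enter). So `len Y_Γ = len Sel₀(ℚ,A) + Σ_{ℓ≠p} ord_p c_ℓ + m − max_v e_v`; and `Y^Γ = Y[T] =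
ker(H/N → ⊕_v H¹(ℚ_v,T)/N_v) = H_ln/N`, `H_ln = p^{max e} ℤ_p x̂ ⊇ N` (global norms are local norms), `len Y^Γ = a − max e`.
(D) Subtract: the unknown indices `a` and `max e` CANCEL —
`len Sel₀(ℚ,E[p^∞]) + Σ_{ℓ≠p} ord_p c_ℓ + ord_p #E(ℚ_p)[p^∞]·[p split] ≤ ind_H(z₁) = ord_p t − ord_p log_ω(x̂)`, and
`len Sel₀(ℚ,A) = ord_p #Ш + (ord_p log_ω(x̂) − min_Q ord_p log_ω(Q))` (`0 → (ℚ_p/ℤ_p)x̂ ∩ ker → Sel₀(ℚ,A) → Ж = Ш[p^∞] → 0`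
in rank `> 0`, Wuthrich; the first term is the cokernel-torsion `D_{E,p}` count). This is EXACTLY the shape of rev 3's
S1♯′ with the booked defect `d = (ord_p ∏c_ℓ − ord_p c_p) + m` — now a LEMMA at every multiplicative `p ≥ 5`, split or
not, with no Kolyvagin-system refinement at all: the Tamagawa SUM comes from the control theorem (where local kernels
MULTIPLY), the Kato input is spent once, Λ-adically, where there are no Tamagawa defects to lose. Equivalently
`∂^{(∞)}(κ^{Kato}) ≥ Σ_{ℓ≠p} ord_p c_ℓ + m` — the «≥» direction of Büyükboduk's Question 2 for Kato's system at
`r_an = 1`, `p ∥ N`, `p ≥ 5`, `ρ̄` onto (Kim 2025 §3: the arithmetic meaning of `∂^{(∞)}` «should [be] reveal[ed]» — open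
in print; BCGS 2023 extract Tamagawa numbers from the FULL main conjecture at good `p`). BSD-CONSISTENCY: Λ-TAM is
predicted with EQUALITY at the minimising `Q` in every regime checked — rank 0 good `p` (`e_s = len Ш/Ж` by
Poitou–Tate), rank 1 good `p` (`−v_min + m = ord_p(#Ẽ(𝔽_p)/p)`), rank 1 non-split `p` (`v_min = 1`, `ord_p(1 + 1/p) =
−1`), rank 1 split `p` (the door chain) — no slack anywhere, the usual signature of correct bookkeeping.

CONSEQUENCES FOR THE SKELETON (6 stubs; k unchanged). S1♭ and S1♯′ MERGE into S1Λ
(`stub_katoLambdaLogBoundTamagawa`: hypothesis `p` multiplicative; defect `(ord_p ∏c_ℓ − ord_p c_p) + m` with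
`c_p := (W.baseChange ℚ_[p]).localTamagawaNumber ℤ_[p]`, the tree's local Tamagawa number); S2′ becomes S2″
(`stub_tateUniformisationLogMinimumTamagawa` = S2′ ∧ «`c_p = ord_p Δ_min`» at split `p`, Tate's algorithm Step 2 —
the identity rev 3 carried as the HYPOTHESIS `hcc` of its door branch is now a provable conjunct); NEW S2ns
(`stub_nonsplitLogMinimum`: at non-split multiplicative `p ≥ 5`, `p ∤ c_p ∈ {1,2}` and a local point with
`ord_p log_ω = 1` — `E(ℚ_p) ⊗ ℤ_p = E₁(ℚ_p) ≅ pℤ_p` by the formal logarithm, `p ∤ c_p·#Ẽ_ns(𝔽_p) = c_p(p+1)`); S3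
unchanged (the door, split `p`); NEW S3ns (`stub_integralNonsplitValue`: the rank-one Perrin-Riou value at a NON-split
multiplicative prime, one-sided integral form, `−1 = ord_p(1 − a_p/p)² /… = ord_p((1 + 1/p)·(unit))` — integral form PRINT-OPEN (rational form: see S3ns), see
its docstring) REPLACES the residual S4′. Composition: split `p` → S2″ ∧ S3 ∧ S1Λ → `sha_le_of_doorTwoGraded` with
`c := ord_p c_p` (ONE branch for door + J3 + J2: no case split on `ord_p ∏c_ℓ = ord_p c_p` any more); non-split `p` →
S2ns ∧ S3ns ∧ S1Λ(`m := 0`, `Q₀ := 0`) → `sha_le_of_nonsplitChain`. COVERAGE of the 404 `ρ̄`-onto census pairs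
(`bsd-stepL/shim/notram_census_j254667.tsv`): 370 split (door 287 + J3 47 + J2 36) through S1Λ ∧ S2″ ∧ S3 — NO
print-open input left besides S3's integral form (S1Λ is a LEMMA with a written proof, S2″ is Tate-curve routine);
34 non-split (27 at `p = 5`, 7 at `p = 7`; smallest 8670u1@5) through S1Λ ∧ S2ns ∧ S3ns — one print-open input, S3ns.
RESIDUAL STUB: none. What is NOT claimed: S3 (research, XL, as rev 2/3) and S3ns (print-open) are values of Kato's
element — the analytic side; everything on the algebraic side of the door is now print or LEMMA.

PRINT vs LEMMA layers of S1Λ (honesty, critic W2 format). PRINT: Kato Thm. 12.4 (3) and 12.5 (4) [Kato2004Asterisque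
pp. 221–222]; the comparison `X₀ ↪ 𝐇²` [Kurihara2002 §; tree file above]; Greenberg's local kernels [GreenbergLNM1716
Lemma 3.3, p. 88; Lemma 3.4]; Poitou–Tate and Tate local duality [Nekovar2006 / Milne ADT]; `Ж = Ш[p^∞]` in positive
rank and the fine leading-term formalism [Wuthrich2007JAG; RaySujatha2021 Thm. 2.5–2.6]. LEMMA (ours): the assembly
(A)–(D), in particular (i) `𝐇¹_Γ = H¹_Iw(G_Σ,T)` (punctual terms die), (ii) the (12.5.1)-exclusion in the Γ-component
at multiplicative `p` (finiteness of `E(ℚ_{p,∞})[p^∞]`), (iii) the cancellation of `a` and `max e`. REMARK level in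
print: rev 3.1's D_p (`∂^{(∞)} ≥ m`) is the `Σ' = 0` case of (D) and is superseded (its KS̄/germ apparatus is no
longer needed; it remains a second proof of the `m`-part).

BARRIER PLACEMENT (catalogue `Literature/Barriers/BirchSwinnertonDyer/`). `StringentKolyvaginCapsAtMax`: EVADED, not
beaten — Λ-TAM is not a local-condition refinement of a Kolyvagin system over `ℚ` (the barrier's technique class); it
is the barrier's own named evasion (i) «an Iwasawa-theoretic / control input» — here Kato's Λ-adic divisibility
12.5 (4) for the FINE Selmer group plus the control theorem, in which local kernels multiply (`∏_v #K_v`), which is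
where the SUM comes from; no IMC equality is used (BCGS need the full IMC only to get EQUALITY; the Euler HALF needs
`⊆`). `ExceptionalZero`: outside — no `p`-adic `L`-function, no `𝓛`-invariant; the fine (= strict) side, where the
trivial-zero phenomenon shows up only as the finite local term `K_p` of order `#E(ℚ_p)[p^∞]` and is booked.
`PAdicHeightNondegeneracy`: outside — no height, no regulator: in rank one the fine complex has `Y^Γ = H_ln/N` and the
would-be regulator is replaced by the INDEX identity `ind_H(z₁) = ord_p g̃(0) + a`, whose unknown `a` cancels. (The
Selmer-side Λ-adic route — Kato 17.4 with `L_p` and the Selmer dual — would need `h_p(x̂) ≠ 0` at non-split `p` and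
the `𝓛`-invariant at split `p`; that is exactly why the line stays on the fine side.)

## The line in one paragraph (rev 4)

For `(E, p)` in the target class (X11b, `p ≥ 5`, `ρ̄_{E,p}` onto, no (ram) prime, `p ∣ ∏ c_ℓ`, no inert-set datum)
the Euler half `ord_p #Ш ≤ ord_p #Ш_an` is read off the BOTTOM LAYER of Kato's `Ω_E`-normalised Λ-adic zeta element —
the tree's ADMISSIBLE class `z₀` (`Kato2004.IsAdmissibleZetaClass`, realisable at `p ≥ 5`, `ρ̄` onto, by the tree's
named fact `exists_isAdmissibleZetaClass_of_imageContainsSL2` = Kato Thm. 12.5 (4)) — through its KUMMER LOGARITHM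
`t = log_ω(loc_p z_ℚ)` (`Kato2004.HasLocPKummerLog`, tree currency, no `B_dR`), NOT through a `p`-adic height:

* `stub_katoLambdaLogBoundTamagawa` S1Λ (LEMMA Λ-TAM, XL; `p` multiplicative, either sign):
  `ord_p #Ш + ord_p log_ω(x̂) − ord_p log_ω(Q) + (ord_p ∏c_ℓ − ord_p c_p) + m ≤ ord_p t − ord_p log_ω(x̂)` for every
  local point `Q` with `log_ω(Q) ≠ 0` and every `m` with a point of order `p^m` in `E(ℚ_p)`.
* `stub_tateUniformisationLogMinimumTamagawa` S2″ (PROVABLE, M–L, Tate curve): `c_p = ord_p Δ_min` and some `m`, a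
  point `Q₀` of order `p^m`, a point `Q` with `log_ω(Q) ≠ 0`, `ord_p log_ω(Q) = 1 − ord_p c_p + m`.
* `stub_nonsplitLogMinimum` S2ns (PROVABLE, M): at non-split `p ≥ 5`, `ord_p c_p = 0` and a point with `ord_p log_ω = 1`.
* `stub_integralExcZeroValue` S3 = THE TRANSFER STATEMENT C⁺ at split `p` (research, XL; the door; verbatim rev 2/3).
* `stub_integralNonsplitValue` S3ns = C⁺ at NON-split `p` (integral form PRINT-OPEN as S3; rational form in print for `p² ∤ N` per Kim's transcription of BDV 2022, XL): same shape, `−1 = ord_p` of the Euler-type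
  factor `(1 + 1/p)`-class constant of Perrin-Riou's formula at a non-split multiplicative prime.
* `stub_printedFactsHeld` S0 (CITE): GZK ∧ Kato Thm. 12.5 (4) realisability (tree named facts).

Composition `EulerHalfNotRamNoInertSetAtFive_of` (kernel-checked, no sorry): GZK gives rank one and a generator
(`exists_isMordellWeilBasis_holds`), Kato 12.5 (4) an admissible class (`exists_datum_of_hasSurjectiveModNGaloisRep`);
on `p` split, S3 gives `(q,t)`, S2″ gives `c_p = ord_p Δ_min` and `(m, Q₀, Q)`, S1Λ the bound, `sha_le_of_doorTwoGraded`;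
on `p` non-split (multiplicative by X11b), S3ns gives `(q,t)`, S2ns gives `ord_p c_p = 0` and `Q`, S1Λ at `m = 0`,
`Q₀ = 0` the bound, `sha_le_of_nonsplitChain`. BSD-tight in both branches, consistent only because
`ord_p #E(ℚ)_tors = 0` (automatic: `ρ̄` onto, `p ≥ 5`) — W1 of rev 2 stands. The crux hypotheses `¬Ram`, `p ∣ ∏c_ℓ`
and the inert-set clause are NOT used by the composition (as in rev 2/3: the line proves the Euler half on the whole
of X11b ∩ {p ≥ 5, ρ̄ onto} modulo its stubs; no stub is thereby stronger than print allows — S3/S3ns are one-sided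
VALUE statements, S1Λ a LEMMA with proof (A)–(D)).

KS-IMPRIMITIVITY LEDGER (card §J of `Lines/kato_Fframe.md`): BSD predicts `∂^{(∞)}(κ^{Kato}) = Σ_{ℓ≠p} ord_p c_ℓ + m`;
rev 3 proved the `m` part (D_p), rev 4 proves the whole «≥» (Λ-TAM (D)); «≤» is not needed for the Euler half.
Why no posited integer interface: as rev 2 (junk-false / non-composing; the waist is tree vocabulary).

Disproof ledger honoured: none of the stubs is an instance of a landed Negative lemma of this crux
(`ledger negatives --problem BirchSwinnertonDyer`: no statement about `HasLocPKummerLog` / admissible classes /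
`MissingUpperBoundAt` / `localTamagawaNumber` at a multiplicative prime is refuted); no stub carries the crux's
conclusion `MissingUpperBoundAt` (rev 3's S4′ did — it is gone); no stub implies the crux or the route leaf cheaply
(probe table in the card); S2″/S2ns are numerically checkable on the census (Tate's algorithm), S1Λ/S3/S3ns are
BSD-predicted (equality) on all 404 pairs.
-/

noncomputable section

open scoped Classical

set_option linter.dupNamespace false

namespace Summit.BirchSwinnertonDyer.BirchSwinnertonDyer.Cruxes.EulerHalfNotRamNoInertSetAtFive.KatoFframe

open Field
open Literature.NumberTheory.GaloisRepresentations
open Literature.NumberTheory.EllipticCurves Literature.NumberTheory.EllipticCurves.Kato2004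
open Literature.NumberTheory.EllipticCurves.Kato2004.EulerSystemValues
open Literature.NumberTheory.EllipticCurves.Rank1Residual
open Literature.NumberTheory.EllipticCurves.Rank1Residual.Typed
open Summit.BirchSwinnertonDyer.Rank1Residual
open Summit.BirchSwinnertonDyer.BirchSwinnertonDyer.Theses.ErratumRoadFive

/-! ## §0 Vocabulary (definitions with bodies; nothing asserted) -/

/-- `E(ℚ) → E(ℚ_p)` on points (Mathlib's `Point.map` along `ℚ → ℚ_p`; same body as the tree's
`WeierstrassCurve.toPadicPoint`). [folklore] -/
abbrev toLocalPoint (W : WeierstrassCurve ℚ) (p : ℕ) [Fact p.Prime] :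
    W.toAffine.Point →+ (W.baseChange ℚ_[p]).toAffine.Point :=
  WeierstrassCurve.Affine.Point.map (W' := W.toAffine) (S := ℚ) (Algebra.ofId ℚ ℚ_[p])

/-- `log_ω(x) ∈ ℚ_p` of a RATIONAL point `x ∈ E(ℚ)` (Néron differential, `W` globally minimal):
`padicLogLocal` of its image in `E(ℚ_p)`. [cite: SilvermanAEC2009, IV.6.4 and VII.2.2] -/
def logOmega (W : WeierstrassCurve ℚ) [W.IsElliptic] [W.IsGloballyMinimal] (p : ℕ) [Fact p.Prime]
    (x : W.toAffine.Point) : ℚ_[p] :=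
  padicLogLocal W p (toLocalPoint W p x)

/-- The BOTTOM LAYER `z_ℚ ∈ H¹(ℚ, T_pE)` of a class `z₀` of a pinned Iwasawa cohomology
`I : IwasawaH1Data W p K γ` (`I.proj 0`, moved to `⊤` by `layerZeroToTop`).
[cite: Kato2004Asterisque, §12.2 (p. 220) and §14.14 (14.14.1) (p. 243)] -/
def bottomClass (W : WeierstrassCurve ℚ) [W.IsElliptic] (p : ℕ) [Fact p.Prime]
    [ContinuousSMul ℤ_[p] (W.tateModule p)] (K : ZpExtension ℚ p) {γ : absoluteGaloisGroup ℚ}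
    (I : IwasawaH1Data W p K γ) (z₀ : I.H) : H1 (tateRep W p) ⊤ :=
  layerZeroToTop W p K (I.proj 0 z₀)


/-! The regimes are stated INLINE in the stub signatures (rev 2 hygiene kept: no `def … : Prop` in a crux
workfile): «`W.HasMultiplicativeReductionAtPrime p`» / «`W.HasSplitMultiplicativeReductionAtPrime p`» / its negation;
the local Tamagawa number at `p` is the tree's «`(W.baseChange ℚ_[p]).localTamagawaNumber ℤ_[p]`» (index of the
good-reduction subgroup of the minimal model; `= ord_p Δ_min` at split `p`, `∈ {1,2}` at non-split `p` — Tate's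
algorithm, carried by S2″ / S2ns as provable conjuncts, NOT as hypotheses); «`addOrderOf Q₀ = p ^ m`» (a local point of
order `p^m`, so `p^m ∣ #E(ℚ_p)[p^∞]`; rev 3's graded datum). -/

/-! ## §1 The registered-shape stubs (k = 6; sorries ONLY here) -/

/-- **S0 (CITE) printed facts held as tree named facts**: Gross–Zagier–Kolyvagin («`r_an ≤ 1 ⇒ rank =
r_an ∧ Ш finite`») and Kato Thm. 12.5 (4) realisability of an admissible zeta class in every pinned
`𝐇¹_Γ(T_pE)` under (12.5.2). Closed at route level by `(h : Fact)` binders, never by a proof here.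
rev 5.4 (LEAD er5-p1 g8 ruling 06:12Z 2026-08-30): ∧ F1′ = Kato Thm. 12.5 (4) LENGTH INEQUALITY on the dual fine Selmer datum at every
height-one prime (tree named fact `Kato2004.lengthAt_fineSelmerDual_le_of_isAdmissibleZetaClass`, p763175; bsd-idea-9 g40, critic V299
READ ✓, referee g85 page-check p. 222) ∧ H2Xʳ = the rank-free GUARDED (14.9.3)+(14.14.2) count on the same `J`
(`Kato2004.exists_iwasawaH2Data_fineSelmerDual_embedding_countRankFree`; bsd-idea-9 g40, referee g85 page-check pp. 239–243) — all three
non-GZK facts and GZK are consumed BY NAME by S1Λ below as leading hypotheses.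
rev 5.6 (LEAD er5-p1 g11): ∧ GZ86 I.(7.3) (`GrossZagier1986_thm_I_7_3`: `#Ш_an ∈ ℚ` in analytic rank one, with GZK) ∧ the two PRINTED
rank-one non-vanishings of the Beilinson–Kato class at `p` (`Venerucci2016_kummerLog_bottomLayer_ne_zero_split`: Invent. math. 203
(2016) Thm. A/B, split multiplicative `p > 3`, `E[p]` irreducible; `BertoliniDarmonVenerucci2022_kummerLog_bottomLayer_ne_zero`: Adv.
Math. 398 (2022) Thm. A in the transcription Kim, Math. Ann. 387 Thm. 2.1/Cor. 2.3, `p` odd, `p² ∤ N`; tree file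
`Literature/…/BeilinsonKatoRankOneNonvanishing.lean`, p768048) — consumed BY NAME by the S3/S3ns theorems below.
[cite: Kato2004Asterisque, Thm. 12.5 (4) with (12.5.1)–(12.5.2) (p. 222), (14.9.3) (p. 240), (14.14.2) (p. 243)] [cite: Darmon2004, Thm. 3.22]
[cite: GrossZagier1986, Thm. I.(7.3)] [cite: Venerucci2016, Thm. A and Thm. B] [cite: BertoliniDarmonVenerucci2022, Thm. A] [cite: Kim2022, Thm. 2.1 and Cor. 2.3] -/
theorem stub_printedFactsHeld :
    rank_eq_analyticRank_of_analyticRank_le_one ∧ exists_isAdmissibleZetaClass_of_imageContainsSL2 ∧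
      lengthAt_fineSelmerDual_le_of_isAdmissibleZetaClass ∧
      exists_iwasawaH2Data_fineSelmerDual_embedding_countRankFree ∧
      GrossZagier1986_thm_I_7_3 ∧ Venerucci2016_kummerLog_bottomLayer_ne_zero_split ∧
      BertoliniDarmonVenerucci2022_kummerLog_bottomLayer_ne_zero := by
  sorry

/-- **S1Λ (LEMMA Λ-TAM, XL; new in rev 4, SUPERSEDES S1♭ AND S1♯′) Kato's Λ-adic divisibility descended through the
fine Selmer group: the logarithmic Kolyvagin-type bound WITH THE WHOLE TAMAGAWA DEFECT BOOKED.** For `p ≥ 5`,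
`ρ̄_{E,p}` onto, `r_an(E) = 1`, `p` MULTIPLICATIVE (split or non-split), a Mordell–Weil generator `x̂ = P 0`, an
admissible Kato class `z₀` with bottom Kummer logarithm `t ≠ 0`, ANY `m` such that `E(ℚ_p)` has a point `Q₀` of order
`p^m`, and ANY local point `Q` with `log_ω(Q) ≠ 0`:
`ord_p #Ш + ord_p log_ω(x̂) − ord_p log_ω(Q) + (ord_p ∏_ℓ c_ℓ − ord_p c_p) + m ≤ ord_p t − ord_p log_ω(x̂)`,
`c_p = (W.baseChange ℚ_[p]).localTamagawaNumber ℤ_[p]`. Proof = header (A)–(D): (A) `H¹(G_Σ,T_pE) = ℤ_p x̂`,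
`𝐇¹_Γ = H¹_Iw(G_Σ,T)` free of rank one (Kato 12.4 (3)), `ind(z₁) = ord_p g̃(0) + a`; (B) `char_Λ X₀(E/ℚ_∞) ∣ (g̃)` from
Kato 12.5 (4) + the tree comparison `X₀ ↪ 𝐇²_Γ` (finite cokernel), the (12.5.1) prime being absent from the
Γ-component because `E(ℚ_{p,∞})[p^∞]` is finite at multiplicative `p`; (C) control for the fine Selmer group in rank
one: `len X₀,Γ = len Sel₀(ℚ) + Σ_{ℓ≠p} ord_p c_ℓ + ord_p #E(ℚ_p)[p^∞] − max e` (Greenberg Lemma 3.3 / p. 88 at `ℓ ≠ p`;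
`K_p = H¹(Γ_p, E(ℚ_{p,∞})[p^∞])` at `p`; Poitou–Tate for the cokernel with `H` cyclic) and `len X₀^Γ = a − max e`;
(D) subtraction — `a`, `max e` cancel — and `len Sel₀(ℚ,E[p^∞]) = ord_p #Ш + ord_p log_ω(x̂) − min ord_p log_ω`
(`Ж = Ш[p^∞]` in positive rank). The inequality only sharpens as `m` grows to `ord_p #E(ℚ_p)[p^∞]` and as `ord_p log_ω(Q)`
drops to its minimum, so the ∀-form over `(m, Q₀, Q)` is implied by the extremal instance. HONESTY LAYER: PRINT =
Kato 12.4 (3) / 12.5 (4), the `X₀ ↪ 𝐇²` comparison (Kurihara / Kobayashi; tree file), Greenberg's local kernels,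
Poitou–Tate / Tate duality, Wuthrich's `Ж = Ш[p^∞]`; LEMMA (ours) = the assembly, items (i)–(iii) of the header.
NEAREST PRINT: Wuthrich's fine leading-term formula `a_r ∼ Reg·#Tors D·∏_{ℓ≠p} c_ℓ·#Ж/#J` (J. Algebraic Geom. 2007;
Ray–Sujatha Thm. 2.6) — at POTENTIALLY GOOD `p`; its numerator is exactly `len X₀,Γ + max e` of (C). BSD predicts S1Λ
with EQUALITY at the minimising `Q` (door, J2, J3, non-split: checked in the header). Why it might fail: (i) a slip in
the LEMMA layer — the (12.5.1)-exclusion (if Kato's exceptional `𝔭` met the Γ-component at `(T)` the bound (B) would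
be off by ONE at `T = 0`; the finiteness of `E(ℚ_{p,∞})[p^∞]` for odd `p` is what excludes it) or the identification
`𝐇^q_{Kato} ↔ H^q_Iw(G_Σ,T)` in degree 2 (only `X₀ ↪ 𝐇²`, finite cokernel, is used — tree comparison file); (ii) as
S1/S1♭: the `ℤ_pˣ`-identification of the admissible bottom layer `z₁` with the class whose Λ-adic lift generates
`Λ z^Λ ⊂ Z(f,T)` after Kato's multiplier is divided out (12.5 (4) bounds by `𝐇¹/Z(f,T)`, a QUOTIENT of `𝐇¹/Λz^Λ` —
right direction). Serves: door (287), J3 (47), J2 (36) at split `p` and J1 (34) at non-split `p` — all 404 pairs.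
[cite: Kato2004Asterisque, Thm. 12.4 (3) (p. 221) and Thm. 12.5 (4) with (12.5.1)–(12.5.2) (p. 222)]
[cite: GreenbergLNM1716, Lemma 3.3 and p. 88, Lemma 3.4] [cite: Kurihara2002, §1] [cite: Wuthrich2007JAG, Thm. 1.1]
[cite: RaySujatha2021, Thm. 2.5 and Thm. 2.6] [cite: Nekovar2006, §0 (Poitou–Tate)] [cite: Kim2025RefinedTNC, §3.5]
[cite: Buyukboduk2009TamagawaDefect, §4.2 Question 2 (arXiv:0710.3858 p. 12)] -/
theorem stub_katoLambdaLogBoundTamagawa :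
    rank_eq_analyticRank_of_analyticRank_le_one →
    lengthAt_fineSelmerDual_le_of_isAdmissibleZetaClass →
    exists_iwasawaH2Data_fineSelmerDual_embedding_countRankFree →
    ∀ (W : WeierstrassCurve ℚ) [W.IsElliptic] [W.IsGloballyMinimal] (p : ℕ) [Fact p.Prime]
      [ContinuousSMul ℤ_[p] (W.tateModule p)],
      5 ≤ p → Surj W p → W.analyticRank = 1 → W.HasMultiplicativeReductionAtPrime p →
      ∀ (h1 : W.mordellWeilRank = 1) (P : Fin W.mordellWeilRank → W.toAffine.Point),
        W.IsMordellWeilBasis P →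
      ∀ (K : ZpExtension ℚ p) (hK : K.IsCyclotomic) (γ : absoluteGaloisGroup ℚ)
        (I : IwasawaH1Data W p K γ) (z₀ : I.H), K.IsTopGenerator γ → IsAdmissibleZetaClass W p K hK I z₀ →
      ∀ t : ℚ_[p], HasLocPKummerLog W p (bottomClass W p K I z₀) t → t ≠ 0 →
      ∀ (m : ℕ) (Q₀ : (W.baseChange ℚ_[p]).toAffine.Point), addOrderOf Q₀ = p ^ m →
      ∀ Q : (W.baseChange ℚ_[p]).toAffine.Point, padicLogLocal W p Q ≠ 0 →
        (padicValNat p W.shaOrder : ℤ) + (logOmega W p (P (Fin.cast h1.symm 0))).valuation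
            - (padicLogLocal W p Q).valuation
            + (((padicValNat p W.tamagawaProduct : ℤ)
                - padicValNat p ((W.baseChange ℚ_[p]).localTamagawaNumber ℤ_[p])) + m) ≤
          t.valuation - (logOmega W p (P (Fin.cast h1.symm 0))).valuation :=
  -- rev 5.5: PROVED — the LEAD's closer (`bottomClass` / `logOmega` unfold definitionally)
  fun hGZK hF1 hH2X =>
    Summit.BirchSwinnertonDyer.BirchSwinnertonDyer.Theorems.ErratumRoadFiveKatoFframeS1Lambda.katoLambdaLogBoundTamagawa
      hGZK hF1 hH2X

/-! ### rev 5: the two WIDTH statements S2″ / S2ns PROVED from tree theorems (stubs in rev 4)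

The proofs below are the bodies of the crux workfiles `Lines/kato_Fframe_r4_S2split_proof.lean` (rev 2, 7e5305b10ca8) and
`Lines/kato_Fframe_r4_S2ns_proof.lean` (7ba4e1ebe3e9), inlined (workfiles are not importable); each compiled there sorry-free,
0 warnings, with axioms `[propext, Classical.choice, Quot.sound]`. -/

section S2proofs

open WeierstrassCurve IsDedekindDomain NumberField
open Summit.BirchSwinnertonDyer.Rank1Residual.X11b
open Summit.BirchSwinnertonDyer.Rank1Residual.Additive
open Summit.BirchSwinnertonDyer.BirchSwinnertonDyer.Theorems.CongruentShaFreeCutKatoKummerLogTorsion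

namespace S2ns

/-- **`p ∤ c_p(E ⊗ ℚ_p)` at a NON-SPLIT multiplicative prime `p ≠ 2`** (`c_p ∈ {1, 2}`, Tate's algorithm
Step 2, transported from the place `v ↔ p` to Mathlib's `ℚ_[p]`).
[cite: SilvermanATAEC1994, IV.9.4 Step 2 (PDF p. 344)] [cite: SilvermanAEC2009, VII.6 Ex. 7.6] -/
theorem not_dvd_localTamagawaNumber_padic_of_nonsplit (W : WeierstrassCurve ℚ) [W.IsElliptic]
    (p : ℕ) [Fact p.Prime] (hp2 : p ≠ 2) (hmult : W.HasMultiplicativeReductionAtPrime p)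
    (hns : ¬ W.HasSplitMultiplicativeReductionAtPrime p) :
    ¬ p ∣ (W.baseChange ℚ_[p]).localTamagawaNumber ℤ_[p] := by
  have hpP : p.Prime := Fact.out
  -- the finite place `v` of `ℚ` under `p`
  set v : HeightOneSpectrum (𝓞 ℚ) := Rat.HeightOneSpectrum.primesEquiv.symm ⟨p, hpP⟩ with hvdef
  have hv : (Rat.HeightOneSpectrum.primesEquiv v : ℕ) = p := by
    rw [hvdef, Equiv.apply_symm_apply]
  have hmult_v : W.HasMultiplicativeReductionAt v :=
    (hasMultiplicativeReductionAtPrime_primesEquiv_iff_holds W v p hv).mp hmult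
  have hns_v : ¬ W.HasSplitMultiplicativeReductionAt v :=
    BirchSwinnertonDyer.Theorems.RamFree.not_hasSplitMultiplicativeReductionAt_of_primesEquiv_eq W v hv hns
  haveI : Finite (IsLocalRing.ResidueField (v.adicCompletionIntegers ℚ)) :=
    HeightOneSpectrum.finite_residueField_adicCompletionIntegers ℚ v
  rw [WeierstrassCurve.localTamagawaNumber_padic_eq_holds W v p hv,
    localTamagawaNumber_of_hasNonsplitMultiplicativeReductionAt_holds v W hmult_v hns_v]
  intro hdvd
  split_ifs at hdvd
  · exact hp2 ((Nat.prime_dvd_prime_iff_eq hpP Nat.prime_two).mp hdvd)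
  · exact hpP.one_lt.ne' (Nat.dvd_one.mp hdvd)

/-- **`p ∤ #E(ℚ_p)_tors` at a non-split multiplicative `p ≥ 3`** (`#E(ℚ_p)_tors ∣ c_p · #Ẽ_ns(𝔽_p)`, both
factors prime to `p`). [cite: SilvermanAEC2009, VII.3 Prop. 3.1, VII.2.1, VII.6.1 and Exercise 3.5] -/
theorem padicValNat_card_torsion_eq_zero_of_nonsplit (W : WeierstrassCurve ℚ) [W.IsElliptic]
    [W.IsGloballyMinimal] (p : ℕ) [Fact p.Prime] (hp3 : 3 ≤ p)
    (hmult : W.HasMultiplicativeReductionAtPrime p) (hns : ¬ W.HasSplitMultiplicativeReductionAtPrime p) :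
    padicValNat p (Nat.card (AddCommGroup.torsion (W.baseChange ℚ_[p]).toAffine.Point)) = 0 := by
  have hpP : p.Prime := Fact.out
  refine padicValNat.eq_zero_of_not_dvd fun hdvd => ?_
  have hdiv := LocalLog.card_torsion_dvd_of_isMinimal (W.baseChange ℚ_[p]) hp3
  rw [LocalTorsion.natCard_point_reduction_baseChange_padic W p] at hdiv
  rcases (Nat.Prime.dvd_mul hpP).mp (dvd_trans hdvd hdiv) with h | h
  · exact not_dvd_localTamagawaNumber_padic_of_nonsplit W p (by omega) hmult hns h
  · exact LocalTorsion.not_dvd_reductionPointCount_of_mult W p hmult h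

/-- **S2ns, PROVED** — the statement of `stub_nonsplitLogMinimum` of `Lines/kato_Fframe_r4.lean` verbatim:
at a non-split multiplicative `p ≥ 5`, `ord_p c_p = 0` and some `Q ∈ E(ℚ_p)` has `log_ω(Q) ≠ 0` of valuation
exactly `1` (the image of `log_ω` on `E(ℚ_p)` is `p ℤ_p`).
[cite: SilvermanAEC2009, IV.6.4 (b), VII.2.2 and VII.6.1] [cite: SilvermanATAEC1994, IV.9.4 (Tate's algorithm, Step 2)] -/
theorem nonsplitLogMinimum :
    ∀ (W : WeierstrassCurve ℚ) [W.IsElliptic] [W.IsGloballyMinimal] (p : ℕ) [Fact p.Prime],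
      5 ≤ p → W.HasMultiplicativeReductionAtPrime p → ¬ W.HasSplitMultiplicativeReductionAtPrime p →
      padicValNat p ((W.baseChange ℚ_[p]).localTamagawaNumber ℤ_[p]) = 0 ∧
      ∃ Q : (W.baseChange ℚ_[p]).toAffine.Point, padicLogLocal W p Q ≠ 0 ∧
        (padicLogLocal W p Q).valuation = 1 := by
  intro W _ _ p _ h5 hmult hns
  have hpP : p.Prime := Fact.out
  have hc0 : padicValNat p ((W.baseChange ℚ_[p]).localTamagawaNumber ℤ_[p]) = 0 :=
    padicValNat.eq_zero_of_not_dvd (not_dvd_localTamagawaNumber_padic_of_nonsplit W p (by omega) hmult hns)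
  have ht0 := padicValNat_card_torsion_eq_zero_of_nonsplit W p (by omega) hmult hns
  refine ⟨hc0, ?_⟩
  -- the image of `log` on `E(ℚ_p)` is `p ℤ_p`
  have hrange := LocalLog.range_padicLog_baseChange_of_mult W p hmult
  rw [ht0, hc0, Nat.cast_zero, add_zero, sub_zero, zpow_one] at hrange
  have hmem : (p : ℚ_[p]) ∈ (LocalLog.padicLog (W.baseChange ℚ_[p])).range := by
    rw [hrange]
    exact Submodule.mem_span_singleton_self _
  obtain ⟨Q, hQ⟩ := AddMonoidHom.mem_range.mp hmem
  refine ⟨Q, ?_, ?_⟩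
  · rw [padicLogLocal_eq_padicLog W p Q, hQ]
    exact_mod_cast hpP.ne_zero
  · rw [padicLogLocal_eq_padicLog W p Q, hQ]
    exact Padic.valuation_p

end S2ns

namespace S2split

/-! ## (a) Kodaira–Néron, split: `c_p(E ⊗ ℚ_p) = ord_p(Δ_min)` -/

/-- **`c_p = ord_p(Δ_min)` at a SPLIT multiplicative prime**, `p`-adic currency: the Tamagawa number of
`W ⊗ ℚ_p` is the `p`-adic valuation of the minimal discriminant of the globally minimal `W`.
[cite: SilvermanATAEC1994, Cor. IV.9.2(d) with (b) (PDF p. 340)] [cite: SilvermanAEC2009, VIII.8] -/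
theorem localTamagawaNumber_padic_eq_padicValInt_of_split (W : WeierstrassCurve ℚ) [W.IsElliptic]
    [W.IsGloballyMinimal] (p : ℕ) [Fact p.Prime] (hsplit : W.HasSplitMultiplicativeReductionAtPrime p) :
    (W.baseChange ℚ_[p]).localTamagawaNumber ℤ_[p] = padicValInt p W.minimalDiscriminantInt := by
  obtain ⟨v, hv⟩ : ∃ v : HeightOneSpectrum ℤ,
      ((Rat.HeightOneSpectrum.primesEquiv (R := ℤ) v : Nat.Primes) : ℕ) = p :=
    ⟨(Rat.HeightOneSpectrum.primesEquiv (R := ℤ)).symm ⟨p, Fact.out⟩,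
      congrArg Subtype.val ((Rat.HeightOneSpectrum.primesEquiv (R := ℤ)).apply_symm_apply _)⟩
  subst hv
  have hs : ((W.baseChange ℚ_[(Rat.HeightOneSpectrum.primesEquiv (R := ℤ) v : ℕ)]).minimal
      ℤ_[(Rat.HeightOneSpectrum.primesEquiv (R := ℤ) v : ℕ)]).HasSplitMultiplicativeReduction
      ℤ_[(Rat.HeightOneSpectrum.primesEquiv (R := ℤ) v : ℕ)] := hsplit
  rw [localTamagawaNumber_padic_eq_of_split _ _ hs, ← W.ordMinimalDiscriminant_eq_padic v,
    W.ordMinimalDiscriminant_eq_padicValInt_natGenerator' v]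
  rfl

/-! ## (c) `E(ℚ_p)[p^∞]` is cyclic at split multiplicative reduction -/

section Local

variable {p : ℕ} [hp : Fact p.Prime] (X : WeierstrassCurve ℚ_[p]) [X.IsMinimal ℤ_[p]] [X.IsElliptic]

/-- **`E₀(ℚ_p) ∩ E(ℚ_p)[p^∞] = 0`** for a minimal equation with `p ≥ 3` and `p ∤ #Ẽ_ns(𝔽_p)`:
`[E₀ : E₁] = #Ẽ_ns(𝔽_p)` kills `Q ∈ E₀` into the torsion-free `E₁(ℚ_p)`, so the order of a `p`-power
torsion `Q ∈ E₀` divides both `#Ẽ_ns(𝔽_p)` and a power of `p`. [cite: SilvermanAEC2009, VII.2.1, VII.3.1] -/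
theorem eq_zero_of_mem_goodReductionSubgroup_of_mem_primaryComponent (hp3 : 3 ≤ p)
    (hn : ¬ p ∣ Nat.card (X.reduction ℤ_[p]).toAffine.Point) {Q : X.toAffine.Point}
    (hQ0 : Q ∈ X.goodReductionSubgroup ℤ_[p])
    (hQp : Q ∈ AddCommGroup.primaryComponent X.toAffine.Point p) : Q = 0 := by
  set F := X.formalFiltration 0 with hF
  set E0 := X.goodReductionSubgroup ℤ_[p] with hE0
  -- `E₁ ≤ E₀` (as in `KimAtThreeFineKatoSATPoints.formalFiltration_zero_le_goodReductionSubgroup`, any reduction type)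
  have hle : F ≤ E0 := by
    obtain ⟨I, hI⟩ : ∃ I : WeierstrassCurve ℤ_[p], X = I.baseChange ℚ_[p] :=
      IsIntegral.integral (R := ℤ_[p]) (W := X)
    subst hI
    rw [hF, hE0, goodReductionSubgroup_baseChange_eq, ← kernelOfReduction_eq_formalFiltration_zero I]
    exact kernelOfReduction_le_nonsingularReductionSubgroup _
  -- `c_p ≠ 0`: `[E : E₁] = c_p · #Ẽ_ns` divides the finite non-zero `[E : E⁽²⁾]`
  have hc : X.localTamagawaNumber ℤ_[p] ≠ 0 := by
    have h2 := LocalLog.index_formalFiltration_two_ne_zero X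
    have hdvd : F.index ∣ (X.formalFiltration 2).index :=
      AddSubgroup.index_dvd_of_le (X.formalFiltration_antitone (show 0 ≤ 2 by norm_num))
    have h0 : F.index ≠ 0 := fun h => h2 (Nat.eq_zero_of_zero_dvd (h ▸ hdvd))
    rw [hF, LocalLog.index_formalFiltration_zero_eq X] at h0
    exact fun h => h0 (by rw [h, zero_mul])
  -- `[E₀ : E₁] = #Ẽ_ns(𝔽_p)`
  have hrel : F.relIndex E0 = Nat.card (X.reduction ℤ_[p]).toAffine.Point := by
    have h := AddSubgroup.relIndex_mul_index hle
    rw [hE0, ← localTamagawaNumber_eq_index_goodReductionSubgroup (R := ℤ_[p]) X, hF,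
      LocalLog.index_formalFiltration_zero_eq X] at h
    have h' : F.relIndex E0 * X.localTamagawaNumber ℤ_[p] =
        Nat.card (X.reduction ℤ_[p]).toAffine.Point * X.localTamagawaNumber ℤ_[p] := by
      rw [h, mul_comm]
    exact Nat.eq_of_mul_eq_mul_right (Nat.pos_of_ne_zero hc) h'
  -- `#Ẽ_ns • Q ∈ E₁`
  have hmem : (F.relIndex E0) • Q ∈ F := by
    have h := (F.addSubgroupOf E0).nsmul_index_mem ⟨Q, hQ0⟩
    rw [AddSubgroup.mem_addSubgroupOf] at h
    exact h
  obtain ⟨k, hk⟩ := (AddCommGroup.mem_primaryComponent).mp hQp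
  have hfin : IsOfFinAddOrder Q :=
    isOfFinAddOrder_iff_nsmul_eq_zero.mpr ⟨p ^ k, pow_pos hp.out.pos _, hk⟩
  have hzero : (F.relIndex E0) • Q = 0 :=
    LocalLog.eq_zero_of_isInReductionKernel_of_isOfFinAddOrder X hp3
      (X.mem_formalFiltration_zero_iff.mp hmem) hfin.nsmul
  have hd1 : addOrderOf Q ∣ Nat.card (X.reduction ℤ_[p]).toAffine.Point :=
    hrel ▸ addOrderOf_dvd_iff_nsmul_eq_zero.mpr hzero
  have hd2 : addOrderOf Q ∣ p ^ k := addOrderOf_dvd_iff_nsmul_eq_zero.mpr hk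
  have hcop : Nat.Coprime (p ^ k) (Nat.card (X.reduction ℤ_[p]).toAffine.Point) :=
    Nat.Coprime.pow_left k ((Nat.Prime.coprime_iff_not_dvd hp.out).mpr hn)
  have hd : addOrderOf Q ∣ 1 := hcop ▸ Nat.dvd_gcd hd2 hd1
  exact AddMonoid.addOrderOf_eq_one_iff.mp (Nat.dvd_one.mp hd)

/-- **`E(ℚ_p)[p^∞]` is CYCLIC at split multiplicative reduction** (`p ≥ 3`, `p ∤ #Ẽ_ns(𝔽_p)`): it embeds
in `E(ℚ_p)/E₀(ℚ_p)`, which is cyclic by Kodaira–Néron (`ℤ_p` is Henselian).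
[cite: SilvermanATAEC1994, Cor. IV.9.2(d) with (b) (PDF p. 340)] [cite: SilvermanAEC2009, VII.2.1, VII.3.1] -/
theorem isAddCyclic_primaryComponent_of_hasSplitMultiplicativeReduction (hp3 : 3 ≤ p)
    (hn : ¬ p ∣ Nat.card (X.reduction ℤ_[p]).toAffine.Point) (hs : X.HasSplitMultiplicativeReduction ℤ_[p]) :
    IsAddCyclic (AddCommGroup.primaryComponent X.toAffine.Point p) := by
  haveI := hs
  haveI := X.isAddCyclic_quotient_goodReductionSubgroup_of_hasSplitMultiplicativeReduction ℤ_[p]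
  set f : AddCommGroup.primaryComponent X.toAffine.Point p →+
      X.toAffine.Point ⧸ X.goodReductionSubgroup ℤ_[p] :=
    (QuotientAddGroup.mk' (X.goodReductionSubgroup ℤ_[p])).comp
      (AddCommGroup.primaryComponent X.toAffine.Point p).subtype with hf
  refine isAddCyclic_of_injective f ((injective_iff_map_eq_zero f).mpr fun a ha => ?_)
  have ha0 : (a : X.toAffine.Point) ∈ X.goodReductionSubgroup ℤ_[p] := by
    rw [hf, AddMonoidHom.comp_apply, AddSubgroup.subtype_apply, QuotientAddGroup.mk'_apply,
      QuotientAddGroup.eq_zero_iff] at ha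
    exact ha
  exact Subtype.ext
    (eq_zero_of_mem_goodReductionSubgroup_of_mem_primaryComponent X hp3 hn ha0 a.2)

/-- **A point of order exactly `p^t`, `t = v_p #E(ℚ_p)_tors`**, at split multiplicative reduction
(`p ≥ 3`, `p ∤ #Ẽ_ns(𝔽_p)`): a generator of the cyclic group `E(ℚ_p)[p^∞]` of order `p^t`.
[cite: SilvermanATAEC1994, Cor. IV.9.2(d)] [cite: SilvermanAEC2009, VII.3.1] -/
theorem exists_addOrderOf_eq_pow_padicValNat_card_torsion (hp3 : 3 ≤ p)
    (hn : ¬ p ∣ Nat.card (X.reduction ℤ_[p]).toAffine.Point) (hs : X.HasSplitMultiplicativeReduction ℤ_[p]) :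
    ∃ Q₀ : X.toAffine.Point,
      addOrderOf Q₀ = p ^ padicValNat p (Nat.card (AddCommGroup.torsion X.toAffine.Point)) := by
  haveI := isAddCyclic_primaryComponent_of_hasSplitMultiplicativeReduction X hp3 hn hs
  obtain ⟨g, hg⟩ :=
    IsAddCyclic.exists_ofOrder_eq_natCard (α := AddCommGroup.primaryComponent X.toAffine.Point p)
  refine ⟨g, ?_⟩
  rw [AddSubgroup.addOrderOf_coe, hg, LocalLog.natCard_primaryComponent_point_eq_pow X]

end Local

/-! ## (a) + (b) + (c): the stub statement -/

/-- **S2″, PROVED** — the statement of `stub_tateUniformisationLogMinimumTamagawa` of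
`Lines/kato_Fframe_r4.lean` verbatim: at a SPLIT multiplicative `p ≥ 5`, `c_p = ord_p(Δ_min)`, and with
`p^t = #E(ℚ_p)[p^∞]` there are a point `Q₀` of order exactly `p^m`, `m := t`, and a point `Q` whose
logarithm generates `log_ω E(ℚ_p) = p^{1+t−v_p c_p} ℤ_p`, i.e. has valuation `1 − v_p(ord_p Δ_min) + m`.
[cite: SilvermanAEC2009, IV.6.4, VII.2.1, VII.3.1, VII.6.1] [cite: SilvermanATAEC1994, Cor. IV.9.2(d) with (b) (PDF p. 340)] -/
theorem tateUniformisationLogMinimumTamagawa :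
    ∀ (W : WeierstrassCurve ℚ) [W.IsElliptic] [W.IsGloballyMinimal] (p : ℕ) [Fact p.Prime],
      5 ≤ p → W.HasSplitMultiplicativeReductionAtPrime p →
      (W.baseChange ℚ_[p]).localTamagawaNumber ℤ_[p] = padicValInt p W.minimalDiscriminantInt ∧
      ∃ (m : ℕ) (Q₀ Q : (W.baseChange ℚ_[p]).toAffine.Point), addOrderOf Q₀ = p ^ m ∧
        padicLogLocal W p Q ≠ 0 ∧
        (padicLogLocal W p Q).valuation =
          1 - (padicValNat p (padicValInt p W.minimalDiscriminantInt) : ℤ) + m := by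
  intro W _ _ p _ h5 hsplit
  have hpP : p.Prime := Fact.out
  have hcp := localTamagawaNumber_padic_eq_padicValInt_of_split W p hsplit
  refine ⟨hcp, ?_⟩
  -- split multiplicative reduction of the chosen `ℤ_p`-minimal model, moved to the globally minimal `W ⊗ ℚ_p`
  have hs : ((W.baseChange ℚ_[p]).minimal ℤ_[p]).HasSplitMultiplicativeReduction ℤ_[p] := hsplit
  have hmult : W.HasMultiplicativeReductionAtPrime p := hs.toHasMultiplicativeReduction
  have hmin : (W.baseChange ℚ_[p]).minimal ℤ_[p] =
      ((W.baseChange ℚ_[p]).exists_isMinimal ℤ_[p]).choose • (W.baseChange ℚ_[p]) := rfl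
  have hsX : (W.baseChange ℚ_[p]).HasSplitMultiplicativeReduction ℤ_[p] :=
    (hasSplitMultiplicativeReduction_iff_of_isMinimal_of_eq_smul ℤ_[p] hmin
      (W.baseChange ℚ_[p]).isUnit_Δ.ne_zero).mp hs
  -- `p ∤ #Ẽ_ns(𝔽_p) = p − 1`
  have hn : ¬ p ∣ Nat.card ((W.baseChange ℚ_[p]).reduction ℤ_[p]).toAffine.Point := by
    have h := LocalTorsion.not_dvd_reductionPointCount_of_mult W p hmult
    rwa [← LocalTorsion.natCard_point_reduction_baseChange_padic W p] at h
  -- (c) the point of order `p^t`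
  obtain ⟨Q₀, hQ₀⟩ :=
    exists_addOrderOf_eq_pow_padicValNat_card_torsion (W.baseChange ℚ_[p]) (by omega) hn hsX
  -- (b) the generator of the image of `log`
  have hrange := LocalLog.range_padicLog_baseChange_of_mult W p hmult
  have hmem : (p : ℚ_[p]) ^ ((1 : ℤ) +
      padicValNat p (Nat.card (AddCommGroup.torsion (W.baseChange ℚ_[p]).toAffine.Point)) -
        padicValNat p ((W.baseChange ℚ_[p]).localTamagawaNumber ℤ_[p])) ∈
      (LocalLog.padicLog (W.baseChange ℚ_[p])).range := by
    rw [hrange]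
    exact Submodule.mem_span_singleton_self _
  obtain ⟨Q, hQ⟩ := AddMonoidHom.mem_range.mp hmem
  refine ⟨padicValNat p (Nat.card (AddCommGroup.torsion (W.baseChange ℚ_[p]).toAffine.Point)),
    Q₀, Q, hQ₀, ?_, ?_⟩
  · rw [padicLogLocal_eq_padicLog W p Q, hQ]
    exact zpow_ne_zero _ (Nat.cast_ne_zero.mpr hpP.ne_zero)
  · rw [padicLogLocal_eq_padicLog W p Q, hQ, Padic.valuation_zpow, Padic.valuation_p, mul_one, hcp]
    ring

end S2split

end S2proofs

/-- **S2″ (PROVED in rev 5 — no longer a stub; rev 3's S2′ ∧ the split Tamagawa identity) Tate-uniformisation log MINIMUM with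
`c_p = ord_p Δ_min`.** At a split multiplicative prime `p ≥ 5`: the local Tamagawa number of the tree
(`(W.baseChange ℚ_[p]).localTamagawaNumber ℤ_[p]` = index of the good-reduction subgroup of the minimal model) equals
`ord_p Δ_min` (Tate's algorithm Step 2: split type `I_n`, `Φ(𝔽_p) ≅ ℤ/n`, `n = ord_p Δ_min = ord_p q_E`; `W` globally
minimal so `W.baseChange ℚ_[p]` is minimal at `p`), AND there are `m : ℕ`, a local point `Q₀` of order EXACTLY `p^m`
and a local point `Q` with `log_ω(Q) ≠ 0` and `ord_p log_ω(Q) = 1 − ord_p(c_p) + m` — witnesses exactly as rev 3's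
S2′ (`E(ℚ_p) ≅ ℚ_pˣ/q^ℤ`, `q = p^e u`, `e = c_p`, `s := ord_p log_p(u) − 1`, `m := min(ord_p e, s) = ord_p #E(ℚ_p)[p^∞]`,
`Q₀ := Φ_Tate(q^{1/p^m})`, `Q := Φ_Tate(p)` if `s < ord_p e`, `Q := Φ_Tate(1 + p)` otherwise). rev 3 carried
`ord_p ∏c_ℓ = ord_p(ord_p Δ_min)` as the HYPOTHESIS `hcc` of its door branch; rev 4 needs the identity itself because
S1Λ speaks of `c_p`, and files it here, where it is provable. Why it might fail: only through the normalisation of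
`padicLogLocal` (as S2′) or through the tree's `localTamagawaNumber` being the index in `W(ℚ_p)` of the good-reduction
subgroup of `W.minimal ℤ_[p]` rather than of `W` itself (they agree: `W` is globally minimal; cf. the tree's bridge
Prop `localTamagawaNumber_padic_eq` and `localTamagawaNumber_of_hasNonsplitMultiplicativeReductionAt_holds` for the
place-indexed normal form). Leans on: tree `SteinWuthrich2013/SplitUniformizationData*`, `padicLogPoint`,
`Tamagawa.lean` (`localTamagawaNumber`, `goodReductionSubgroup`), `KodairaSymbol`/Tate's algorithm files.
[cite: SilvermanATAEC1994, IV.9.4 (Tate's algorithm, Step 2), V.3.1, V.4.1 and V.5.3] [cite: SilvermanAEC2009, IV.6.4 (b)]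
[cite: Kim2022StructureSelmer, Prop. 3.1] -/
theorem tateUniformisationLogMinimumTamagawa :
    ∀ (W : WeierstrassCurve ℚ) [W.IsElliptic] [W.IsGloballyMinimal] (p : ℕ) [Fact p.Prime],
      5 ≤ p → W.HasSplitMultiplicativeReductionAtPrime p →
      (W.baseChange ℚ_[p]).localTamagawaNumber ℤ_[p] = padicValInt p W.minimalDiscriminantInt ∧
      ∃ (m : ℕ) (Q₀ Q : (W.baseChange ℚ_[p]).toAffine.Point), addOrderOf Q₀ = p ^ m ∧
        padicLogLocal W p Q ≠ 0 ∧
        (padicLogLocal W p Q).valuation =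
          1 - (padicValNat p (padicValInt p W.minimalDiscriminantInt) : ℤ) + m :=
  S2split.tateUniformisationLogMinimumTamagawa

/-- **S2ns (PROVED in rev 5 — no longer a stub; new in rev 4) the local minimum at a NON-SPLIT multiplicative prime.** At a non-split
multiplicative prime `p ≥ 5`: `p ∤ c_p` (Tate's algorithm: non-split `I_n` has `c_p ∈ {1,2}`; tree
`localTamagawaNumber_of_hasNonsplitMultiplicativeReductionAt_holds`, `localTamagawaNumber_dvd_two_of_nonsplit`), and
there is a local point `Q` with `log_ω(Q) ≠ 0` and `ord_p log_ω(Q) = 1`: `#Ẽ_ns(𝔽_p) = p + 1` and `c_p ∣ 2` are prime to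
`p`, so `E(ℚ_p) ⊗ ℤ_p = E₁(ℚ_p) ⊗ ℤ_p` and the formal logarithm maps `E₁(ℚ_p) = Ê(pℤ_p)` isomorphically onto `pℤ_p`
(`p ≥ 3`: no torsion in `Ê(pℤ_p)`, `log` and `exp` converge on `pℤ_p`); take `Q ∈ E₁(ℚ_p)` with `log_ω(Q) = p`. (So
`min_Q ord_p log_ω(Q) = 1` and `E(ℚ_p)[p] = 0`: the S1Λ instance used at non-split `p` is `m = 0`, `Q₀ = 0`.) Why it
might fail: only through the normalisation of `padicLogLocal` (`log(m₀•Q)/m₀` with `m₀ = [E(ℚ_p):E₁(ℚ_p)] = c_p(p+1)`,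
prime to `p` — harmless). Leans on: tree `padicLogPoint` / `padicLogLocal`, `NonsplitProofs.lean`, formal group files.
[cite: SilvermanAEC2009, IV.6.4 (b), VII.2.2 and VII.6.1] [cite: SilvermanATAEC1994, IV.9.4 (Tate's algorithm, Step 2)] -/
theorem nonsplitLogMinimum :
    ∀ (W : WeierstrassCurve ℚ) [W.IsElliptic] [W.IsGloballyMinimal] (p : ℕ) [Fact p.Prime],
      5 ≤ p → W.HasMultiplicativeReductionAtPrime p → ¬ W.HasSplitMultiplicativeReductionAtPrime p →
      padicValNat p ((W.baseChange ℚ_[p]).localTamagawaNumber ℤ_[p]) = 0 ∧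
      ∃ Q : (W.baseChange ℚ_[p]).toAffine.Point, padicLogLocal W p Q ≠ 0 ∧
        (padicLogLocal W p Q).valuation = 1 :=
  S2ns.nonsplitLogMinimum

/-! ### rev 5.6: the research ATOMS as the registered stubs; S3 / S3ns become theorems

The two new stubs are the binders `hVsplit` / `hVnonsplit` of `ErratumRoadFiveKatoFframeValueAtoms.integral{ExcZero,Nonsplit}Value_of_atoms`
(p766845) verbatim — pure valuation inequalities, the only research content of the line (LEAD g10/g11, referee g86, pen g49 (α)-note). -/

/-- **S3♭ (RESEARCH, XL — the research ATOM of the door at a SPLIT multiplicative prime) the integral exceptional-zero Perrin-Riou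
VALUE, pure valuation form.** For `(E,p)` in X11b with `p ≥ 5`, `ρ̄_{E,p}` onto, `p` split multiplicative, a Mordell–Weil generator
`x̂ = P 0`, an admissible Kato class `z₀`, ANY non-zero Kummer logarithm `t` of its bottom layer and ANY rational `q` with `#Ш_an = q`:
`ord_p t − 2·ord_p log_ω(x̂) ≤ ord_p q + ord_p ∏ c_ℓ − 2·ord_p #E(ℚ)_tors − 1` (`−1 = ord_p(1 − p⁻¹)`). This is S3 with its three PRINT
conjuncts removed (`∃ q` = GZ86 I.(7.3); `∃ t` = Kummer theory in positive rank, a tree theorem; `t ≠ 0` = Venerucci 2016): the statement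
BSD ∧ Kato's main conjecture (equality at `T = 0`) predict with EQUALITY (the chain S1Λ ∧ S2″ is tight); NOT in print (Venerucci 2016
Thm. A (1) gives `log = ℓ₁·log²(𝐏)` with `ℓ₁ ∈ ℚˣ` unpinned; the Λ-adic extraction needs `h_p(x̂) ≠ 0`, barrier
`PAdicHeightNondegeneracy`; workfile `Lines/kato_Fframe_r5_RESIDUE_g10.md`). Why it might fail: an uncancelled `p`-power in the
unwinding constants (Manin constant over the totally real field, Mok's `ξ(2)`, Petersson ratios), exactly as S3. Signature = binder
`hVsplit` of `ErratumRoadFiveKatoFframeValueAtoms.integralExcZeroValue_of_atoms` verbatim (referee g86 token record, 819 chars).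
**rev 5.7: the statement is the ROUTE ITEM `Theses.ErratumRoadFive.KatoValuationIneqSplitAtFive` (item stmt-BirchSwinnertonDyer-33168, aside r401) BY NAME — its gate-rendered
text is this rev 5.6 text as terms (`Iff.rfl`, pen sketch 702e85b98cbb3e5c); the rev 5.6 display form is kept in the card.**
[cite: Venerucci2016, Thm. A] [cite: PerrinRiou1993AIF, §3.3] [cite: Kato2004Asterisque, Thm. 12.5 (4) (p. 222)] -/
theorem stub_valuationIneqSplit :
    Summit.BirchSwinnertonDyer.BirchSwinnertonDyer.Theses.ErratumRoadFive.KatoValuationIneqSplitAtFive := by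
  sorry

/-- **S3ns♭ (RESEARCH, XL — the research ATOM at a NON-SPLIT multiplicative prime) the integral non-split Perrin-Riou VALUE, pure
valuation form.** As S3♭ with `p` non-split multiplicative (multiplicative by X11b); `−1 = ord_p(1 + p⁻¹)`. S3ns with its three PRINT
conjuncts removed (`t ≠ 0` = BDV 2022 Thm. A via Kim 2022); BSD ∧ Kato's main conjecture predict EQUALITY (S1Λ ∧ S2ns tight); NOT in
print (BDV rational only; BSTW 2024's two-variable integral machinery is printed for `p ∤ 2N` only — door `BstwZetaNonsplitDoorSketch`
research stub A♭). Signature = binder `hVnonsplit` of `ErratumRoadFiveKatoFframeValueAtoms.integralNonsplitValue_of_atoms` verbatim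
(referee g86 token record, 821 chars).
**rev 5.7: the statement is the ROUTE ITEM `Theses.ErratumRoadFive.KatoValuationIneqNonsplitAtFive` (item stmt-BirchSwinnertonDyer-33169, aside r402) BY NAME — its gate-rendered
text is this rev 5.6 text as terms (`Iff.rfl`, pen sketch 702e85b98cbb3e5c); the rev 5.6 display form is kept in the card.**
[cite: BertoliniDarmonVenerucci2022, Thm. A] [cite: BurungaleSkinnerTianWan2024, Conj. 1.12 and Thm. 1.13] [cite: PerrinRiou1993AIF, §3.3] -/
theorem stub_valuationIneqNonsplit :
    Summit.BirchSwinnertonDyer.BirchSwinnertonDyer.Theses.ErratumRoadFive.KatoValuationIneqNonsplitAtFive := by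
  sorry

/-! ### rev 5.6 §1b: the two printed non-vanishings reshaped to the binder forms (3-line proofs; same as
`Theorems/ErratumRoadFiveKatoFframeNonvanishingOfPrint.lean` §1) -/

/-- `hNZsplit` of `integralExcZeroValue_of_atoms` from S0's Venerucci fact (`ρ̄` onto ⇒ `E[p]` irreducible).
[cite: Venerucci2016, Thm. A and Thm. B] [cite: Serre1972, §4] -/
theorem kummerLog_ne_zero_split_of_fact (hV : Venerucci2016_kummerLog_bottomLayer_ne_zero_split) :
    ∀ (W : WeierstrassCurve ℚ) [W.IsElliptic] [W.IsGloballyMinimal] (p : ℕ) [Fact p.Prime]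
      [ContinuousSMul ℤ_[p] (W.tateModule p)],
      5 ≤ p → Surj W p → W.analyticRank = 1 → W.HasSplitMultiplicativeReductionAtPrime p →
      ∀ (K : ZpExtension ℚ p) (hK : K.IsCyclotomic) (γ : absoluteGaloisGroup ℚ)
        (I : IwasawaH1Data W p K γ) (z₀ : I.H), K.IsTopGenerator γ → IsAdmissibleZetaClass W p K hK I z₀ →
      ∀ t : ℚ_[p], HasLocPKummerLog W p (layerZeroToTop W p K (I.proj 0 z₀)) t → t ≠ 0 := by
  intro W _ _ p _ _ h5 hsurj hr hsplit K hK γ I z₀ hγ hz t ht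
  haveI : NeZero (p : ℚ) := ⟨Nat.cast_ne_zero.mpr (Fact.out : p.Prime).ne_zero⟩
  exact hV W p (by omega) hsplit (hasIrreducibleModPGaloisRep_of_hasSurjectiveModNGaloisRep W p hsurj) hr
    K hK γ I z₀ hγ hz t ht

/-- `hNZnonsplit` of `integralNonsplitValue_of_atoms` from S0's BDV fact (multiplicative ⇒ `f_p = 1` ⇒ `p² ∤ N`).
[cite: BertoliniDarmonVenerucci2022, Thm. A] [cite: Kim2022, Cor. 2.3] [cite: Silverman1994, IV.10.2 (b)] -/
theorem kummerLog_ne_zero_nonsplit_of_fact (hB : BertoliniDarmonVenerucci2022_kummerLog_bottomLayer_ne_zero) :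
    ∀ (W : WeierstrassCurve ℚ) [W.IsElliptic] [W.IsGloballyMinimal] (p : ℕ) [Fact p.Prime]
      [ContinuousSMul ℤ_[p] (W.tateModule p)],
      5 ≤ p → Surj W p → W.analyticRank = 1 → W.HasMultiplicativeReductionAtPrime p →
      ¬ W.HasSplitMultiplicativeReductionAtPrime p →
      ∀ (K : ZpExtension ℚ p) (hK : K.IsCyclotomic) (γ : absoluteGaloisGroup ℚ)
        (I : IwasawaH1Data W p K γ) (z₀ : I.H), K.IsTopGenerator γ → IsAdmissibleZetaClass W p K hK I z₀ →
      ∀ t : ℚ_[p], HasLocPKummerLog W p (layerZeroToTop W p K (I.proj 0 z₀)) t → t ≠ 0 := by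
  intro W _ _ p _ _ h5 _ hr hmult _ K hK γ I z₀ hγ hz t ht
  refine hB W p (by omega) ?_ hr K hK γ I z₀ hγ hz t ht
  have hpP : p.Prime := Fact.out
  have hN : W.conductorNorm ℤ ≠ 0 := (W.conductorNorm_pos_holds).ne'
  rw [hpP.pow_dvd_iff_le_factorization hN, W.factorization_conductorNorm_eq_one_of_hasMultiplicativeReductionAtPrime p hmult]
  omega

/-- **S3 (THEOREM in rev 5.6 ⟸ S0's GZK ∕ GZ86 ∕ Venerucci facts + S3♭ `stub_valuationIneqSplit`, via `ErratumRoadFiveKatoFframeValueAtoms.integralExcZeroValue_of_atoms`, `bottomClass`∕`logOmega` unfolding definitionally; statement byte-identical to rev 5.5. Was: THE TRANSFER C⁺, XL — the door) integral exceptional-zero Perrin-Riou value, valuation form,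
upper half.** For `(E,p)` in X11b with `p ≥ 5`, `ρ̄_{E,p}` onto and `p` SPLIT multiplicative, a Mordell–Weil
generator `x̂ = P 0` and an admissible Kato class `z₀`: `#Ш_an` is a rational `q`, the bottom layer of `z₀`
has a NON-ZERO Kummer logarithm `t` (Venerucci Thm. A (2) + Thm. B at `r_an = 1`), and
`ord_p t − 2·ord_p log_ω(x̂) ≤ ord_p q + ord_p ∏ c_ℓ − 2·ord_p #E(ℚ)_tors − 1` (`−1 = ord_p(1 − p⁻¹)`).
Print: equality up to `ℚˣ` (Venerucci 2016 Thm. A `log_A(res_p ζ^{BK}) = ℓ₁ log_A²(𝐏)` [arXiv:1407.1913 p. 3];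
Disegni 2020 Prop. 5). Proposed proof of the integral form = F-frame chain S3–S6 of
`Lines/kato_bottom_layer_Fframe.md` rev 1.3 (Stage 2). Why it might fail: an uncancelled `p`-power in the
unwinding constants (Manin constant of the Shimura-curve parametrisation over `F`, Mok's `ξ(2)`, the
Petersson-measure ratio — audited to `κ = 0` in words only), or `ℓ₁`'s `ord_p(q_E)` entering with the
wrong sign. BOOKKEEPING (critic W1): the term `− 2·ord_p #E(ℚ)_tors` is `0` here (`ρ̄` onto, `p ≥ 5` ⇒ `E(ℚ)[p] = 0`)
and the door chain S1 ∧ S2 ∧ S3 is BSD-consistent — indeed BSD-TIGHT, equalities throughout — ONLY because of it;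
do not «generalise» S3 to `p ∣ #E(ℚ)_tors`. Standing hypotheses of the print support (Venerucci Thm. A):
conductor `Np`, `p > 3` split multiplicative, `A_p` irreducible, `L(A,1) = 0`; no hypothesis on `ord_p(q_A)`.
[cite: Venerucci2016, Thm. A] [cite: Disegni2020, Prop. 5] [cite: Mok2011, Thm. 1.1] [cite: PerrinRiou1993AIF, §3.3] -/
theorem stub_integralExcZeroValue :
    ∀ (W : WeierstrassCurve ℚ) [W.IsElliptic] [W.IsGloballyMinimal] (p : ℕ) [Fact p.Prime]
      [ContinuousSMul ℤ_[p] (W.tateModule p)],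
      ClassX11b W p → 5 ≤ p → Surj W p → W.HasSplitMultiplicativeReductionAtPrime p →
      ∀ (h1 : W.mordellWeilRank = 1) (P : Fin W.mordellWeilRank → W.toAffine.Point),
        W.IsMordellWeilBasis P →
      ∀ (K : ZpExtension ℚ p) (hK : K.IsCyclotomic) (γ : absoluteGaloisGroup ℚ)
        (I : IwasawaH1Data W p K γ) (z₀ : I.H), K.IsTopGenerator γ → IsAdmissibleZetaClass W p K hK I z₀ →
      ∃ (q : ℚ) (t : ℚ_[p]), shaAn W = (q : ℂ) ∧ HasLocPKummerLog W p (bottomClass W p K I z₀) t ∧ t ≠ 0 ∧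
        t.valuation - 2 * (logOmega W p (P (Fin.cast h1.symm 0))).valuation ≤
          padicValRat p q + padicValNat p W.tamagawaProduct - 2 * padicValNat p W.torsionOrder - 1 :=
  fun W _ _ p _ _ =>
    Summit.BirchSwinnertonDyer.BirchSwinnertonDyer.Theorems.ErratumRoadFiveKatoFframeValueAtoms.integralExcZeroValue_of_atoms
      stub_printedFactsHeld.1 stub_printedFactsHeld.2.2.2.2.1 (kummerLog_ne_zero_split_of_fact stub_printedFactsHeld.2.2.2.2.2.1)
      stub_valuationIneqSplit W p

/-- **S3ns (THEOREM in rev 5.6 ⟸ S0's GZK ∕ GZ86 ∕ BDV facts + S3ns♭ `stub_valuationIneqNonsplit`, via `…ValueAtoms.integralNonsplitValue_of_atoms`; statement byte-identical to rev 5.5. Was: THE TRANSFER C⁺ at a NON-SPLIT multiplicative prime; integral form PRINT-OPEN (as S3), XL; new in rev 4, REPLACES the residual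
S4′) integral Perrin-Riou value at non-split `p`, valuation form, upper half.** For `(E,p)` in X11b with `p ≥ 5`,
`ρ̄_{E,p}` onto and `p` NON-split multiplicative (multiplicative by X11b), a Mordell–Weil generator `x̂ = P 0` and an
admissible Kato class `z₀`: `#Ш_an` is a rational `q`, the bottom layer of `z₀` has a NON-ZERO Kummer logarithm `t`,
and `ord_p t − 2·ord_p log_ω(x̂) ≤ ord_p q + ord_p ∏ c_ℓ − 2·ord_p #E(ℚ)_tors − 1`. Here `−1 = ord_p` of the local
factor of Perrin-Riou's conjectural formula `log_ω(res_p z^{Kato}) ≐ (Euler-type factor)·(L′(E,1)/Ω·Reg_∞)·log_ω(x̂)²`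
at a non-split multiplicative prime (`a_p = −1`, no exceptional zero: `(1 − a_p p^{-1})`-type factor `(1 + 1/p)`, a
`p`-adic unit times `p^{-1}`) — the SAME right-hand side as S3, predicted by BSD with EQUALITY given S1Λ ∧ S2ns
(`v_min = 1`, `m = 0`: header consistency check). PRINT STATUS (searched g39; corrected rev 4.1): the RATIONAL
form of Perrin-Riou's conjecture, `log_ω res_p(z_Kato) = ℓ₁·log_ω(P)²` with an unspecified `ℓ₁ ∈ ℚˣ`, is in print for
`p` SPLIT multiplicative (Venerucci 2016 Thm. A [corpus: paper:arxiv-1407.1913 p. 3]) and is ATTRIBUTED to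
Bertolini–Darmon–Venerucci 2022 for every odd `p` with `p² ∤ N` — hence also NON-split multiplicative `p` — by two
careful secondary sources (Kim, arXiv:2109.12344, Thm. 2.1 [corpus: p. 5: «p an odd prime with p² ∤ N … up to
multiplication by a non-zero rational number»]; Kim 2025, arXiv:2505.09121, Thm. 1.2 (rk1+ε) [corpus: p. 5: «p² ∤ N,
α_p ≠ β_p (when p ∤ N)»]) and by the zbMATH review zbl:1495.11066 («p ≥ 3 … semistable reduction at p»), while
Burungale–Skinner–Tian–Wan (arXiv:2409.01350 ll. 1017–1019) describe BDV as «the good reduction case» and prove their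
Thm. 1.13 for `p ∤ 2N` (BST: `p ∤ 6N`, Kim loc. cit. Rem. 2.2); BDV's own text is cite-only here (acq-02715). WHAT S3ns
NEEDS is the INTEGRAL form — `ord_p ℓ₁` pinned to `ord_p(#Ш_an·∏c_ℓ/#E(ℚ)_tors²) − 1` one-sidedly — and that is open in
print at non-split `p` EXACTLY AS S3's integral form is open at split `p` (same status, not worse; the rational form
fixes `t ≠ 0` and the `log²` shape only). The nearest print at non-split `p` with integral content is on the HEIGHT
side (Disegni 2020: rank-one `p`-adic BSD at non-split multiplicative `p` via Disegni's `p`-adic Gross–Zagier 2017),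
which converts to a VALUE of `log res_p z` only through `h_p(x̂) ≠ 0`
(catalogued barrier `PAdicHeightNondegeneracy`) — so it is NOT a substitute. Proposed proof: the F-frame chain of
`Lines/kato_bottom_layer_Fframe.md` (Stage 2) run at a non-split prime (no `𝓛`-invariant step: the two-variable
argument degenerates to the one-variable Perrin-Riou/Coleman-map computation `Col(z)(𝟙) = (1 − a_p/p)·…`, Kobayashi /
Kurihara style, with `a_p = −1`), or a direct extension of BSTW's method to `p ∥ N` non-split. Why it might fail: it is
a research statement (integral form not in print); an uncancelled `p`-power in the unwinding constants exactly as for S3; or the local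
factor at non-split `p` carrying a different `p`-power than `(1 + 1/p)` in the correctly normalised formula (BSD says
not: the chain is tight with `−1`). BOOKKEEPING (critic W1 format): `− 2·ord_p #E(ℚ)_tors = 0` here, as in S3.
Serves the J1 pairs (34 of 404: 27 at `p = 5`, 7 at `p = 7`; smallest 8670u1@5, 14560d1@5, 15390r1@5, 17955m1@7).
[cite: PerrinRiou1993AIF, §3.3] [cite: Venerucci2016, Thm. A] [cite: BertoliniDarmonVenerucci2022, Thm. A]
[cite: BurungaleSkinnerTianWan2024, Conj. 1.12 and Thm. 1.13] [cite: Disegni2020, Prop. 5] [cite: Kato2004Asterisque, Thm. 16.6] -/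
theorem stub_integralNonsplitValue :
    ∀ (W : WeierstrassCurve ℚ) [W.IsElliptic] [W.IsGloballyMinimal] (p : ℕ) [Fact p.Prime]
      [ContinuousSMul ℤ_[p] (W.tateModule p)],
      ClassX11b W p → 5 ≤ p → Surj W p → ¬ W.HasSplitMultiplicativeReductionAtPrime p →
      ∀ (h1 : W.mordellWeilRank = 1) (P : Fin W.mordellWeilRank → W.toAffine.Point),
        W.IsMordellWeilBasis P →
      ∀ (K : ZpExtension ℚ p) (hK : K.IsCyclotomic) (γ : absoluteGaloisGroup ℚ)
        (I : IwasawaH1Data W p K γ) (z₀ : I.H), K.IsTopGenerator γ → IsAdmissibleZetaClass W p K hK I z₀ →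
      ∃ (q : ℚ) (t : ℚ_[p]), shaAn W = (q : ℂ) ∧ HasLocPKummerLog W p (bottomClass W p K I z₀) t ∧ t ≠ 0 ∧
        t.valuation - 2 * (logOmega W p (P (Fin.cast h1.symm 0))).valuation ≤
          padicValRat p q + padicValNat p W.tamagawaProduct - 2 * padicValNat p W.torsionOrder - 1 :=
  fun W _ _ p _ _ =>
    Summit.BirchSwinnertonDyer.BirchSwinnertonDyer.Theorems.ErratumRoadFiveKatoFframeValueAtoms.integralNonsplitValue_of_atoms
      stub_printedFactsHeld.1 stub_printedFactsHeld.2.2.2.2.1 (kummerLog_ne_zero_nonsplit_of_fact stub_printedFactsHeld.2.2.2.2.2.2)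
      stub_valuationIneqNonsplit W p


/-! ## §2 The composition (kernel-checked; concludes the crux BY NAME) -/

/-- The GRADED bottom-layer chain, as pure arithmetic over `ℤ` (rev 2, kept): a bound `hB` carrying a booked defect
`d` on the left, the local minimum `hQ : vQ = 1 − c + m` and the C⁺ value `hC` give
`sha ≤ vq + (ctot − c − d) + m − 2·vtors` — the Euler half exactly when `d` reaches `(ctot − c) + m`. -/
theorem sha_le_graded_of_chain (sha vx vQ vt vq ctot c m d vtors : ℤ)
    (hB : sha + vx - vQ + d ≤ vt - vx) (hQ : vQ = 1 - c + m)
    (hC : vt - 2 * vx ≤ vq + ctot - 2 * vtors - 1) :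
    sha ≤ vq + (ctot - c - d) + m - 2 * vtors := by
  omega

/-- The split branch (rev 4 = rev 3's `sha_le_of_doorTwoGraded`, now the ONLY split branch; `d = (ctot − c) + m`,
`c = ord_p c_p`): `hB` = S1Λ, `hQ` = S2″, `hC` = S3; NO sign condition on `ctot − c`, no case split on `ctot = c`. -/
theorem sha_le_of_doorTwoGraded (sha vx vQ vt vq ctot c m vtors : ℤ)
    (hB : sha + vx - vQ + ((ctot - c) + m) ≤ vt - vx) (hQ : vQ = 1 - c + m)
    (hC : vt - 2 * vx ≤ vq + ctot - 2 * vtors - 1) (htors : 0 ≤ vtors) :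
    sha ≤ vq := by
  have h := sha_le_graded_of_chain sha vx vQ vt vq ctot c m ((ctot - c) + m) vtors hB hQ hC
  omega

/-- The non-split branch (new in rev 4; `c = 0`, `m = 0`): `hB` = S1Λ at `m = 0`, `Q₀ = 0` with its defect term
rewritten to `ctot` by S2ns (`hd`), `hQ : vQ = 1` = S2ns, `hC` = S3ns. -/
theorem sha_le_of_nonsplitChain (sha vx vQ vt vq ctot vtors d : ℤ)
    (hB : sha + vx - vQ + d ≤ vt - vx) (hd : d = ctot) (hQ : vQ = 1)
    (hC : vt - 2 * vx ≤ vq + ctot - 2 * vtors - 1) (htors : 0 ≤ vtors) :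
    sha ≤ vq := by
  omega

/-- **`EulerHalfNotRamNoInertSetAtFive` from the six stubs (rev 4).** (rev 5.2: result stated as `id <crux>` —
definitionally the crux — so that only `_of_stubs` below concludes the crux decl by name for the gate `skeleton check`.) GZK gives rank one and a Mordell–Weil generator
(tree theorem `exists_isMordellWeilBasis_holds`), Kato 12.5 (4) an admissible class (tree corollary
`exists_datum_of_hasSurjectiveModNGaloisRep`); on `p` split multiplicative: S3 the value, S2″ the Tamagawa identity and
the graded local witnesses `(m, Q₀, Q)`, S1Λ the bound, `sha_le_of_doorTwoGraded`; on `p` non-split (multiplicative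
by X11b): S3ns the value, S2ns `ord_p c_p = 0` and the witness `Q`, S1Λ at `m = 0`, `Q₀ = 0`,
`sha_le_of_nonsplitChain`. -/
theorem EulerHalfNotRamNoInertSetAtFive_of
    (hF : rank_eq_analyticRank_of_analyticRank_le_one ∧ exists_isAdmissibleZetaClass_of_imageContainsSL2)
    (hS1 : ∀ (W : WeierstrassCurve ℚ) [W.IsElliptic] [W.IsGloballyMinimal] (p : ℕ) [Fact p.Prime]
      [ContinuousSMul ℤ_[p] (W.tateModule p)],
      5 ≤ p → Surj W p → W.analyticRank = 1 → W.HasMultiplicativeReductionAtPrime p →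
      ∀ (h1 : W.mordellWeilRank = 1) (P : Fin W.mordellWeilRank → W.toAffine.Point),
        W.IsMordellWeilBasis P →
      ∀ (K : ZpExtension ℚ p) (hK : K.IsCyclotomic) (γ : absoluteGaloisGroup ℚ)
        (I : IwasawaH1Data W p K γ) (z₀ : I.H), K.IsTopGenerator γ → IsAdmissibleZetaClass W p K hK I z₀ →
      ∀ t : ℚ_[p], HasLocPKummerLog W p (bottomClass W p K I z₀) t → t ≠ 0 →
      ∀ (m : ℕ) (Q₀ : (W.baseChange ℚ_[p]).toAffine.Point), addOrderOf Q₀ = p ^ m →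
      ∀ Q : (W.baseChange ℚ_[p]).toAffine.Point, padicLogLocal W p Q ≠ 0 →
        (padicValNat p W.shaOrder : ℤ) + (logOmega W p (P (Fin.cast h1.symm 0))).valuation
            - (padicLogLocal W p Q).valuation
            + (((padicValNat p W.tamagawaProduct : ℤ)
                - padicValNat p ((W.baseChange ℚ_[p]).localTamagawaNumber ℤ_[p])) + m) ≤
          t.valuation - (logOmega W p (P (Fin.cast h1.symm 0))).valuation)
    (hS2 : ∀ (W : WeierstrassCurve ℚ) [W.IsElliptic] [W.IsGloballyMinimal] (p : ℕ) [Fact p.Prime],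
      5 ≤ p → W.HasSplitMultiplicativeReductionAtPrime p →
      (W.baseChange ℚ_[p]).localTamagawaNumber ℤ_[p] = padicValInt p W.minimalDiscriminantInt ∧
      ∃ (m : ℕ) (Q₀ Q : (W.baseChange ℚ_[p]).toAffine.Point), addOrderOf Q₀ = p ^ m ∧
        padicLogLocal W p Q ≠ 0 ∧
        (padicLogLocal W p Q).valuation =
          1 - (padicValNat p (padicValInt p W.minimalDiscriminantInt) : ℤ) + m)
    (hS2n : ∀ (W : WeierstrassCurve ℚ) [W.IsElliptic] [W.IsGloballyMinimal] (p : ℕ) [Fact p.Prime],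
      5 ≤ p → W.HasMultiplicativeReductionAtPrime p → ¬ W.HasSplitMultiplicativeReductionAtPrime p →
      padicValNat p ((W.baseChange ℚ_[p]).localTamagawaNumber ℤ_[p]) = 0 ∧
      ∃ Q : (W.baseChange ℚ_[p]).toAffine.Point, padicLogLocal W p Q ≠ 0 ∧
        (padicLogLocal W p Q).valuation = 1)
    (hS3 : ∀ (W : WeierstrassCurve ℚ) [W.IsElliptic] [W.IsGloballyMinimal] (p : ℕ) [Fact p.Prime]
      [ContinuousSMul ℤ_[p] (W.tateModule p)],
      ClassX11b W p → 5 ≤ p → Surj W p → W.HasSplitMultiplicativeReductionAtPrime p →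
      ∀ (h1 : W.mordellWeilRank = 1) (P : Fin W.mordellWeilRank → W.toAffine.Point),
        W.IsMordellWeilBasis P →
      ∀ (K : ZpExtension ℚ p) (hK : K.IsCyclotomic) (γ : absoluteGaloisGroup ℚ)
        (I : IwasawaH1Data W p K γ) (z₀ : I.H), K.IsTopGenerator γ → IsAdmissibleZetaClass W p K hK I z₀ →
      ∃ (q : ℚ) (t : ℚ_[p]), shaAn W = (q : ℂ) ∧ HasLocPKummerLog W p (bottomClass W p K I z₀) t ∧ t ≠ 0 ∧
        t.valuation - 2 * (logOmega W p (P (Fin.cast h1.symm 0))).valuation ≤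
          padicValRat p q + padicValNat p W.tamagawaProduct - 2 * padicValNat p W.torsionOrder - 1)
    (hS3n : ∀ (W : WeierstrassCurve ℚ) [W.IsElliptic] [W.IsGloballyMinimal] (p : ℕ) [Fact p.Prime]
      [ContinuousSMul ℤ_[p] (W.tateModule p)],
      ClassX11b W p → 5 ≤ p → Surj W p → ¬ W.HasSplitMultiplicativeReductionAtPrime p →
      ∀ (h1 : W.mordellWeilRank = 1) (P : Fin W.mordellWeilRank → W.toAffine.Point),
        W.IsMordellWeilBasis P →
      ∀ (K : ZpExtension ℚ p) (hK : K.IsCyclotomic) (γ : absoluteGaloisGroup ℚ)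
        (I : IwasawaH1Data W p K γ) (z₀ : I.H), K.IsTopGenerator γ → IsAdmissibleZetaClass W p K hK I z₀ →
      ∃ (q : ℚ) (t : ℚ_[p]), shaAn W = (q : ℂ) ∧ HasLocPKummerLog W p (bottomClass W p K I z₀) t ∧ t ≠ 0 ∧
        t.valuation - 2 * (logOmega W p (P (Fin.cast h1.symm 0))).valuation ≤
          padicValRat p q + padicValNat p W.tamagawaProduct - 2 * padicValNat p W.torsionOrder - 1) :
    id EulerHalfNotRamNoInertSetAtFive := by
  intro W _ _ p _ hX h5 hSurj hnRam hTam hNoS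
  haveI : ContinuousSMul ℤ_[p] (W.tateModule p) := TateModule.continuousSMul_padicInt
  have hr1 : W.analyticRank = 1 := hX.1
  have hmult : W.HasMultiplicativeReductionAtPrime p := hX.2.2.1
  have hmw : W.mordellWeilRank = 1 := by
    have h := (hF.1 W (le_of_eq hr1)).1
    omega
  obtain ⟨P, hP⟩ := W.exists_isMordellWeilBasis_holds
  obtain ⟨K, hK, γ, I, z₀, hγ, hz⟩ := hF.2.exists_datum_of_hasSurjectiveModNGaloisRep W p h5 hSurj
  by_cases hsplit : W.HasSplitMultiplicativeReductionAtPrime p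
  · obtain ⟨q, t, hq, ht, ht0, hC⟩ := hS3 W p hX h5 hSurj hsplit hmw P hP K hK γ I z₀ hγ hz
    obtain ⟨hcp, m, Q₀, Q, hQ₀, hQ0, hQv⟩ := hS2 W p h5 hsplit
    refine ⟨q, hq, ?_⟩
    have hB := hS1 W p h5 hSurj hr1 hmult hmw P hP K hK γ I z₀ hγ hz t ht ht0 m Q₀ hQ₀ Q hQ0
    rw [hcp] at hB
    exact sha_le_of_doorTwoGraded _ _ _ _ _ _ _ _ _ hB hQv hC (by positivity)
  · obtain ⟨q, t, hq, ht, ht0, hC⟩ := hS3n W p hX h5 hSurj hsplit hmw P hP K hK γ I z₀ hγ hz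
    obtain ⟨hc0, Q, hQ0, hQv⟩ := hS2n W p h5 hmult hsplit
    refine ⟨q, hq, ?_⟩
    have hB := hS1 W p h5 hSurj hr1 hmult hmw P hP K hK γ I z₀ hγ hz t ht ht0 0 0 (by simp) Q hQ0
    exact sha_le_of_nonsplitChain _ _ _ _ _ _ _ _ hB (by rw [hc0]; simp) hQv hC (by positivity)

/-- **rev 5 composition on the FOUR remaining stubs** (S0, S1Λ, S3, S3ns): the width obligations S2″ / S2ns are
theorems of this file. (rev 5.2: result stated as `id <crux>`, see `_of`.) -/
theorem EulerHalfNotRamNoInertSetAtFive_of4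
    (hF : rank_eq_analyticRank_of_analyticRank_le_one ∧ exists_isAdmissibleZetaClass_of_imageContainsSL2)
    (hS1 : ∀ (W : WeierstrassCurve ℚ) [W.IsElliptic] [W.IsGloballyMinimal] (p : ℕ) [Fact p.Prime]
      [ContinuousSMul ℤ_[p] (W.tateModule p)],
      5 ≤ p → Surj W p → W.analyticRank = 1 → W.HasMultiplicativeReductionAtPrime p →
      ∀ (h1 : W.mordellWeilRank = 1) (P : Fin W.mordellWeilRank → W.toAffine.Point),
        W.IsMordellWeilBasis P →
      ∀ (K : ZpExtension ℚ p) (hK : K.IsCyclotomic) (γ : absoluteGaloisGroup ℚ)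
        (I : IwasawaH1Data W p K γ) (z₀ : I.H), K.IsTopGenerator γ → IsAdmissibleZetaClass W p K hK I z₀ →
      ∀ t : ℚ_[p], HasLocPKummerLog W p (bottomClass W p K I z₀) t → t ≠ 0 →
      ∀ (m : ℕ) (Q₀ : (W.baseChange ℚ_[p]).toAffine.Point), addOrderOf Q₀ = p ^ m →
      ∀ Q : (W.baseChange ℚ_[p]).toAffine.Point, padicLogLocal W p Q ≠ 0 →
        (padicValNat p W.shaOrder : ℤ) + (logOmega W p (P (Fin.cast h1.symm 0))).valuation
            - (padicLogLocal W p Q).valuation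
            + (((padicValNat p W.tamagawaProduct : ℤ)
                - padicValNat p ((W.baseChange ℚ_[p]).localTamagawaNumber ℤ_[p])) + m) ≤
          t.valuation - (logOmega W p (P (Fin.cast h1.symm 0))).valuation)
    (hS3 : ∀ (W : WeierstrassCurve ℚ) [W.IsElliptic] [W.IsGloballyMinimal] (p : ℕ) [Fact p.Prime]
      [ContinuousSMul ℤ_[p] (W.tateModule p)],
      ClassX11b W p → 5 ≤ p → Surj W p → W.HasSplitMultiplicativeReductionAtPrime p →
      ∀ (h1 : W.mordellWeilRank = 1) (P : Fin W.mordellWeilRank → W.toAffine.Point),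
        W.IsMordellWeilBasis P →
      ∀ (K : ZpExtension ℚ p) (hK : K.IsCyclotomic) (γ : absoluteGaloisGroup ℚ)
        (I : IwasawaH1Data W p K γ) (z₀ : I.H), K.IsTopGenerator γ → IsAdmissibleZetaClass W p K hK I z₀ →
      ∃ (q : ℚ) (t : ℚ_[p]), shaAn W = (q : ℂ) ∧ HasLocPKummerLog W p (bottomClass W p K I z₀) t ∧ t ≠ 0 ∧
        t.valuation - 2 * (logOmega W p (P (Fin.cast h1.symm 0))).valuation ≤
          padicValRat p q + padicValNat p W.tamagawaProduct - 2 * padicValNat p W.torsionOrder - 1)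
    (hS3n : ∀ (W : WeierstrassCurve ℚ) [W.IsElliptic] [W.IsGloballyMinimal] (p : ℕ) [Fact p.Prime]
      [ContinuousSMul ℤ_[p] (W.tateModule p)],
      ClassX11b W p → 5 ≤ p → Surj W p → ¬ W.HasSplitMultiplicativeReductionAtPrime p →
      ∀ (h1 : W.mordellWeilRank = 1) (P : Fin W.mordellWeilRank → W.toAffine.Point),
        W.IsMordellWeilBasis P →
      ∀ (K : ZpExtension ℚ p) (hK : K.IsCyclotomic) (γ : absoluteGaloisGroup ℚ)
        (I : IwasawaH1Data W p K γ) (z₀ : I.H), K.IsTopGenerator γ → IsAdmissibleZetaClass W p K hK I z₀ →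
      ∃ (q : ℚ) (t : ℚ_[p]), shaAn W = (q : ℂ) ∧ HasLocPKummerLog W p (bottomClass W p K I z₀) t ∧ t ≠ 0 ∧
        t.valuation - 2 * (logOmega W p (P (Fin.cast h1.symm 0))).valuation ≤
          padicValRat p q + padicValNat p W.tamagawaProduct - 2 * padicValNat p W.torsionOrder - 1) :
    id EulerHalfNotRamNoInertSetAtFive := by
  exact EulerHalfNotRamNoInertSetAtFive_of hF hS1 tateUniformisationLogMinimumTamagawa nonsplitLogMinimum hS3 hS3n

/-- **THE skeleton theorem (rev 5.2; rev 5.6: S0 has seven conjuncts, S3/S3ns are theorems over the stubs S3♭/S3ns♭): the crux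
`ErratumRoadFive.EulerHalfNotRamNoInertSetAtFive` BY NAME from the registered stubs BY NAME** — S0 `stub_printedFactsHeld`, S1Λ
`stub_katoLambdaLogBoundTamagawa` (theorem since rev 5.5), S3 `stub_integralExcZeroValue` / S3ns `stub_integralNonsplitValue` (theorems since
rev 5.6, over `stub_valuationIneqSplit` / `stub_valuationIneqNonsplit`) — via `_of4` (which feeds the in-file theorems S2″ `tateUniformisationLogMinimumTamagawa` and S2ns
`nonsplitLogMinimum` to the six-binder composition `_of`). Same statement and same mathematical content as the rev-5.1 `_of_stubs`
(there: `_of` applied to the six names); only the order of the file and the head of the two conditional results changed. A skeleton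
registration (by the LEAD / pen only, W-79) records exactly these four stub signatures. -/
theorem EulerHalfNotRamNoInertSetAtFive_of_stubs : EulerHalfNotRamNoInertSetAtFive :=
  EulerHalfNotRamNoInertSetAtFive_of4 ⟨stub_printedFactsHeld.1, stub_printedFactsHeld.2.1⟩
    (stub_katoLambdaLogBoundTamagawa stub_printedFactsHeld.1 stub_printedFactsHeld.2.2.1
      stub_printedFactsHeld.2.2.2.1)
    stub_integralExcZeroValue stub_integralNonsplitValue

end Summit.BirchSwinnertonDyer.BirchSwinnertonDyer.Cruxes.EulerHalfNotRamNoInertSetAtFive.KatoFframe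

end
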